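import Literature.NumberTheory.Sieve.LinearEquationsInPrimesGvNCore
import Literature.NumberTheory.Sieve.LinearEquationsInPrimesPseudorandom
import HarnessLib

/-!
# The reduced generalised von Neumann theorem: the linear forms averages (Green–Tao 2010, App. C)

Trunk T-SIEVE (`Literature/NumberTheory/Sieve`). Fourth file of the App. B/C layer of the
decomposition of `Literature.NumberTheory.Sieve.GreenTaoZiegler2012_finiteComplexity`, towards the discharge of
`Literature.NumberTheory.Sieve.GreenTao2010_generalisedVonNeumann` (Prop. 7.1). The core inequality
`Literature.NumberTheory.Sieve.coreGvN` (`LinearEquationsInPrimesGvNCore.lean`) leaves four kinds of averages of the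
majorant: `A₀, A₁, A₂` (the cases "`n = 0, 1, 2`" of App. C) and the lower weights
`‖ν_B‖_{□^B(ν)}` (the lower-weight estimate). B. Green, T. Tao, *Linear equations in primes*,
Ann. of Math. 171 (2010), App. C shows that each is `1 + o(1)` by the linear forms condition
(Def. 6.2), after verifying that the relevant systems of affine forms — the doubled forms
`ψ_i(x^{(ω_C)}_C, y)`, the cube forms `z + ∑ ω_j h_j`, and the forms of the sextuple average
`𝔼_*` with the pivot coordinate substituted (the "slightly alarming expression") — have finite
complexity and bounded integer coefficients ("one can clear denominators"). This file carries
that out, for the quantitative linear forms condition `Literature.NumberTheory.Sieve.LinearFormsCondition` of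
`LinearEquationsInPrimesPseudorandom.lean`:

* `Literature.NumberTheory.Sieve.IntFormSys` — systems of integer affine forms indexed by arbitrary finite types, their
  averages `𝔼_v ∏_φ ν(φ(v))` as `Literature.NumberTheory.Sieve.linearFormsAverage`s (`linearFormsAverage_toAffLin`), and the
  resulting instance of the linear forms condition (`IntFormSys.abs_expect_prod_sub_one_le`);
* `Literature.NumberTheory.Sieve.SplitSys` — the data of App. C after permuting the basis (coefficients in split
  coordinates, distinguished form, `Ω(i)`, `I(B)`, `θ_i`, `a_j`, `b₀`), and the concrete
  families `F_B`, `ν_B` (`SplitSys.fFam`, `SplitSys.νfam`) with their dependence, domination and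
  regrouping properties;
* `SplitSys.sysA₀`, `SplitSys.sysT`, `SplitSys.sysA₂` — the three derived systems, the
  identities `A₀ = 𝔼 ∏ ν(sysA₀)`, `‖ν_B‖_{□^B(ν)}^{2^{|B|}} = 𝔼 ∏ ν(sysT B)` (and `A₁`, the case
  `B = A`), `A₂ = 𝔼 ∏ ν(sysA₂)` (dilating all free variables by the pivot coefficient), their
  finite complexity (via explicit *recovery maps* inverting the doubling and the pivot
  substitution, `SplitSys.recov`), non-constancy, coefficient bounds and sizes;
* `SplitSys.coreGvN_concrete` — the reduced generalised von Neumann theorem for split systems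
  with `k ≥ 2` private coordinates and arbitrary single-coordinate cutoffs `|χ_v| ≤ 1`:
  `|𝔼_p ∏_i g_i(θ_i p) ∏_v χ_v(p_v)|^{2^k} ≤ (‖g_{i₀}‖_{U^k}^{2^k} + ((1+η)4η)^{1/2}) (1+η)^{2^k-1}`
  under the `(D,D,D)`-linear forms condition with error `η`, `D ≥ Literature.coreDegree k d' t L`.

## References

* B. Green, T. Tao, *Linear equations in primes*, Ann. of Math. (2) 171 (2010), 1753–1850
  (arXiv:math/0606088), App. C: the lower-weight estimate and its proof, the three estimates
  "for `n = 0, 1, 2`", the sextuple average `𝔼_*` and its constraints, the substitution for the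
  pivot coordinate, the "slightly alarming expression" and the verification that no two of the
  forms are affinely dependent; Def. 6.2 (linear forms condition).
-/

noncomputable section

open Finset
open scoped BigOperators

namespace Literature.NumberTheory.Sieve


/-! ### Formal systems of integer affine forms and the linear forms condition -/

section formalsys

/-- A finite system of integer affine forms `φ(v) = ∑_c coeff_φ(c) v_c + const_φ` in variables of
a finite type `V`, indexed by a finite type `Φ` (the systems of App. C are naturally indexed by
cube vertices and fibre copies rather than by `[t]`). [cite: GreenTao2010, Def. 1.1 and Def. 6.2] -/
structure IntFormSys (Φ V : Type*) where
  /-- the linear coefficients -/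
  coeff : Φ → V → ℤ
  /-- the constant terms -/
  const : Φ → ℤ

namespace IntFormSys

variable {Φ V : Type*}

/-- The value of the form `φ` at `v ∈ ℤ_M^V` (forms "induced … in the obvious manner").
[cite: GreenTao2010, Def. 6.2] -/
def evalZ [Fintype V] (S : IntFormSys Φ V) (M : ℕ) (φ : Φ) (v : V → ZMod M) : ZMod M :=
  ∑ c, (S.coeff φ c : ZMod M) * v c + (S.const φ : ZMod M)

/-- Finite complexity: no two linear parts are parallel. [cite: GreenTao2010, Def. 1.5 / Cor. 1.7] -/
def FiniteComplexity (S : IntFormSys Φ V) : Prop :=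
  ∀ φ φ', φ ≠ φ' → ∀ a b : ℤ, a • S.coeff φ = b • S.coeff φ' → a = 0 ∧ b = 0

/-- Every form is non-constant. [cite: GreenTao2010, Def. 1.1] -/
def Nonzero (S : IntFormSys Φ V) : Prop :=
  ∀ φ, S.coeff φ ≠ 0

/-- All linear coefficients are bounded by `L` in magnitude. [cite: GreenTao2010, Def. 6.2] -/
def CoeffBound (S : IntFormSys Φ V) (L : ℕ) : Prop :=
  ∀ φ c, |S.coeff φ c| ≤ L

variable [Fintype Φ] [Fintype V] [DecidableEq V]

/-- The system as a `Fin T → AffLinForm D` system, for enumerations of the forms and the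
variables. [folklore] -/
def toAffLin {D T : ℕ} (S : IntFormSys Φ V) (eV : V ≃ Fin D) (eΦ : Fin T ≃ Φ) :
    Fin T → AffLinForm D :=
  fun i => ⟨fun j => S.coeff (eΦ i) (eV.symm j), S.const (eΦ i)⟩

/-- The linear forms average of the enumerated system is `𝔼_v ∏_φ ν(φ(v))`. [folklore] -/
theorem linearFormsAverage_toAffLin {D T M : ℕ} [NeZero M] (S : IntFormSys Φ V) (eV : V ≃ Fin D)
    (eΦ : Fin T ≃ Φ) (ν : ZMod M → ℝ) :
    linearFormsAverage ν (S.toAffLin eV eΦ) = 𝔼 v : V → ZMod M, ∏ φ, ν (S.evalZ M φ v) := by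
  unfold linearFormsAverage
  rw [Fintype.expect_eq_sum_div_card, Fintype.card_fun, ZMod.card, Nat.cast_pow]
  have hD : Fintype.card V = D := by rw [Fintype.card_congr eV, Fintype.card_fin]
  rw [hD]
  congr 1
  -- reindex variables by `eV` and forms by `eΦ`
  rw [← Fintype.sum_equiv (Equiv.arrowCongr eV (Equiv.refl (ZMod M))).symm]
  intro n
  rw [← Fintype.prod_equiv eΦ]
  intro i
  congr 1
  simp only [toAffLin, AffLinForm.modEval, evalZ]
  congr 1
  rw [← Fintype.sum_equiv eV.symm]
  intro j
  simp [Equiv.arrowCongr]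

omit [Fintype Φ] [Fintype V] [DecidableEq V] in
/-- Finite complexity transfers to the enumerated system. [folklore] -/
theorem isFiniteComplexitySystem_toAffLin {D T : ℕ} (S : IntFormSys Φ V) (eV : V ≃ Fin D)
    (eΦ : Fin T ≃ Φ) (h : S.FiniteComplexity) : IsFiniteComplexitySystem (S.toAffLin eV eΦ) := by
  intro i j hij a b hab
  refine h (eΦ i) (eΦ j) (fun h' => hij (eΦ.injective h')) a b ?_
  funext c
  have := congr_fun hab (eV c)
  simpa [toAffLin] using this

omit [Fintype Φ] [Fintype V] [DecidableEq V] in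
/-- Non-degeneracy of the enumerated system. [folklore] -/
theorem isNondegenerateSystem_toAffLin {D T : ℕ} (S : IntFormSys Φ V) (eV : V ≃ Fin D)
    (eΦ : Fin T ≃ Φ) (h : S.FiniteComplexity) (h0 : S.Nonzero) :
    IsNondegenerateSystem (S.toAffLin eV eΦ) := by
  refine (S.isFiniteComplexitySystem_toAffLin eV eΦ h).isNondegenerateSystem fun i h' => ?_
  apply h0 (eΦ i)
  funext c
  have := congr_fun h' (eV c)
  simpa [toAffLin] using this

/-- **The linear forms condition for a formal system**: if `ν` satisfies the `(D₀,D₀,D₀)`-linear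
forms condition with error `η`, and `S` is a finite-complexity system of non-constant forms with
at most `D₀` forms, at most `D₀` variables and coefficients at most `D₀`, then
`|𝔼_v ∏_φ ν(φ(v)) - 1| ≤ η`. [cite: GreenTao2010, Def. 6.2] -/
theorem abs_expect_prod_sub_one_le {M : ℕ} [NeZero M] {D₀ : ℕ} {η : ℝ} {ν : ZMod M → ℝ}
    (hLFC : LinearFormsCondition D₀ D₀ D₀ η ν) (S : IntFormSys Φ V) (hfc : S.FiniteComplexity)
    (h0 : S.Nonzero) {L : ℕ} (hco : S.CoeffBound L) (hL : L ≤ D₀)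
    (hΦ1 : 1 ≤ Fintype.card Φ) (hΦ : Fintype.card Φ ≤ D₀)
    (hV1 : 1 ≤ Fintype.card V) (hV : Fintype.card V ≤ D₀) :
    |(𝔼 v : V → ZMod M, ∏ φ, ν (S.evalZ M φ v)) - 1| ≤ η := by
  set eV : V ≃ Fin (Fintype.card V) := Fintype.equivFin V
  set eΦ : Fin (Fintype.card Φ) ≃ Φ := (Fintype.equivFin Φ).symm
  rw [← S.linearFormsAverage_toAffLin eV eΦ ν]
  refine hLFC _ _ hV1 hV hΦ1 hΦ (S.toAffLin eV eΦ)
    (S.isNondegenerateSystem_toAffLin eV eΦ hfc h0)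
    (S.isFiniteComplexitySystem_toAffLin eV eΦ hfc) fun i j => ?_
  exact (hco _ _).trans (by exact_mod_cast hL)

end IntFormSys

end formalsys



/-! ### Split systems: the data of App. C after permuting the basis -/

section splitsys

variable {k d' t : ℕ}

/-- A system of `t` integer affine forms in split coordinates `(x, y) ∈ ℤ^k × ℤ^{d'}` with a
distinguished index `i₀`: coefficient vectors `c i`, constants `κ i`. The hypotheses of the
reduced generalised von Neumann theorem are: finite complexity, non-constancy, `c i₀(x_j) ≠ 0`
for all private `j`, and every other form misses some private coordinate.
[cite: GreenTao2010, App. C (Proposition 7.1″ and the sets `Ω(i)`)] -/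
structure SplitSys (k d' t : ℕ) where
  /-- linear coefficients in split coordinates -/
  c : Fin t → SplitIdx k d' → ℤ
  /-- constant terms -/
  κ : Fin t → ℤ
  /-- the distinguished form -/
  i₀ : Fin t

namespace SplitSys

variable (S : SplitSys k d' t)

/-- Finite complexity of the split system `S` (a hypothesis on `S`, cf. `SplitSys.coreGvN_concrete`):
no two coefficient vectors are parallel. [cite: GreenTao2010, Def. 1.5 and Lemma 1.6] -/
def FC (S : SplitSys k d' t) : Prop :=
  ∀ i i', i ≠ i' → ∀ a b : ℤ, a • S.c i = b • S.c i' → a = 0 ∧ b = 0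

/-- Non-constancy of every form of `S` (a hypothesis on `S`). [cite: GreenTao2010, Def. 1.1] -/
def NZ (S : SplitSys k d' t) : Prop := ∀ i, S.c i ≠ 0

/-- The distinguished form involves every private coordinate.
[cite: GreenTao2010, App. C ("`∏_{j=1}^{s+1} ψ̇_i(e_j)` … is non-zero for `i = 1`")] -/
def Top (S : SplitSys k d' t) : Prop := ∀ j, S.c S.i₀ (Sum.inl j) ≠ 0

/-- Every other form misses some private coordinate.
[cite: GreenTao2010, App. C ("`∏_{j=1}^{s+1} ψ̇_i(e_j)` vanishes for `i ≠ 1`")] -/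
def Low (S : SplitSys k d' t) : Prop := ∀ i, i ≠ S.i₀ → ∃ j, S.c i (Sum.inl j) = 0

/-- Coefficient bound. [cite: GreenTao2010, §3 (`‖Ψ‖_N ≤ L`)] -/
def Bound (L : ℕ) : Prop := ∀ i v, |S.c i v| ≤ L

/-- `Ω(i)`: the private coordinates the form `i` involves, as a subset of the doubled set `A`.
[cite: GreenTao2010, App. C ("the set `Ω(i)` of indices `j ∈ [s+1]` for which `ψ̇_i(e_j) ≠ 0`")] -/
def Ω (i : Fin t) : Finset (SplitIdx k d') :=
  (Finset.univ.filter fun j => S.c i (Sum.inl j) ≠ 0).map ⟨Sum.inl, Sum.inl_injective⟩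

/-- The forms attached to `B ⊆ A`: those with `Ω(i) = B`.
[cite: GreenTao2010, App. C ("group the forms according to their associated set `Ω(i)`")] -/
def I (B : Finset (SplitIdx k d')) : Finset (Fin t) :=
  Finset.univ.filter fun i => S.Ω i = B

/-- The value of the form `i` at `p ∈ ℤ_{N'}^{k+d'}`. [cite: GreenTao2010, Def. 6.2] -/
def θ (N' : ℕ) (i : Fin t) (p : SplitIdx k d' → ZMod N') : ZMod N' :=
  ∑ v, (S.c i v : ZMod N') * p v + (S.κ i : ZMod N')

/-- The unit coefficients `a_j = c_{i₀}(x_j)` of the distinguished form (mod `N'`).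
[cite: GreenTao2010, App. C] -/
def a (N' : ℕ) (j : Fin k) : ZMod N' := (S.c S.i₀ (Sum.inl j) : ZMod N')

/-- `b₀(y) = ψ_{i₀}(0, y)`. [cite: GreenTao2010, App. C (`ψ₁(0,y)`)] -/
def b₀ (N' : ℕ) (y : Fin d' → ZMod N') : ZMod N' :=
  ∑ m, (S.c S.i₀ (Sum.inr m) : ZMod N') * y m + (S.κ S.i₀ : ZMod N')

/-- The distinguished form is `topForm a b₀`. [cite: GreenTao2010, App. C] -/
theorem θ_i₀ (N' : ℕ) (p : SplitIdx k d' → ZMod N') :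
    S.θ N' S.i₀ p = topForm (S.a N') (S.b₀ N') p := by
  unfold θ topForm a b₀
  rw [Fintype.sum_sum_type]
  ring

/-- `Ω(i) ⊆ A`. [folklore] -/
theorem Ω_subset (i : Fin t) : S.Ω i ⊆ privSet k d' := by
  intro v hv
  obtain ⟨j, _, rfl⟩ := Finset.mem_map.mp hv
  simp [privSet]

/-- Membership in `Ω(i)`. [folklore] -/
theorem mem_Ω {i : Fin t} {j : Fin k} : Sum.inl j ∈ S.Ω i ↔ S.c i (Sum.inl j) ≠ 0 := by
  unfold Ω
  simp

/-- `inr m ∉ Ω(i)`. [folklore] -/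
theorem inr_not_mem_Ω (i : Fin t) (m : Fin d') : Sum.inr m ∉ S.Ω i := by
  unfold Ω; simp

/-- `Ω(i₀) = A`. [cite: GreenTao2010, App. C ("Thus `Ω(1) = [s+1]`")] -/
theorem Ω_i₀ (hT : S.Top) : S.Ω S.i₀ = privSet k d' := by
  refine Finset.Subset.antisymm (S.Ω_subset _) fun v hv => ?_
  simp only [privSet, Finset.mem_map, Finset.mem_univ, true_and, Function.Embedding.coeFn_mk] at hv
  obtain ⟨j, rfl⟩ := hv
  exact S.mem_Ω.mpr (hT j)

/-- `Ω(i) ⊊ A` for `i ≠ i₀`. [cite: GreenTao2010, App. C ("`Ω(i) ⊊ [s+1]` for `i = 2,…,t`")] -/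
theorem Ω_ssubset (hL : S.Low) {i : Fin t} (hi : i ≠ S.i₀) : S.Ω i ⊂ privSet k d' := by
  refine Finset.ssubset_iff_subset_ne.mpr ⟨S.Ω_subset i, fun h => ?_⟩
  obtain ⟨j, hj⟩ := hL i hi
  have : Sum.inl j ∈ S.Ω i := by rw [h]; simp [privSet]
  exact S.mem_Ω.mp this hj

/-- `I(A) = {i₀}`. [cite: GreenTao2010, App. C ("`F_{[s+1],y} = f₁(ψ₁(x_{[s+1]},y))`")] -/
theorem I_privSet (hT : S.Top) (hL : S.Low) : S.I (privSet k d') = {S.i₀} := by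
  ext i
  simp only [I, Finset.mem_filter, Finset.mem_univ, true_and, Finset.mem_singleton]
  constructor
  · intro h
    by_contra hi
    exact (S.Ω_ssubset hL hi).ne h
  · rintro rfl; exact S.Ω_i₀ hT

/-- **Non-constancy is implied by finite complexity once `t ≥ 2`.** Def. 1.1 requires of a
system both that "all the affine-linear forms are non-constant" (`NZ`) and that "no two forms are
rational multiples of each other" (here in the stronger finite-complexity form `FC`,
Def. 1.5 / Lemma 1.6); for `t ≥ 2` the first clause follows from the second, since a vanishing
linear part `ċ_i = 0` gives the dependence `1 • ċ_i = 0 • ċ_{i'}` with any `i' ≠ i`. (`NZ` itself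
is a hypothesis on `S`, not a theorem: the zero system with `t = 1` violates it.)
[cite: GreenTao2010, §1, Def. 1.1 ("To avoid trivial degeneracies we shall require that all the
affine-linear forms are non-constant and no two forms are rational multiples of each other")] -/
theorem nz_of_fc (hfc : S.FC) (ht : 2 ≤ t) : S.NZ := by
  intro i hi
  obtain ⟨i', hi'⟩ : ∃ i' : Fin t, i' ≠ i := by
    by_cases h : i.val = 0
    · exact ⟨⟨1, by omega⟩, fun e => by rw [Fin.ext_iff] at e; simp only at e; omega⟩
    · exact ⟨⟨0, by omega⟩, fun e => by rw [Fin.ext_iff] at e; simp only at e; omega⟩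
  exact one_ne_zero (hfc i i' (Ne.symm hi') 1 0 (by rw [hi, smul_zero, zero_smul])).1

/-- **The hypotheses `FC` and `Top` (with `k ≥ 1`) of the reduced generalised von Neumann theorem
already give `NZ`**: the distinguished form is non-constant by `Top`, every other form by finite
complexity against it. In particular the hypothesis `hnz : S.NZ` of
`SplitSys.coreGvN_concrete` (`k ≥ 2`) is supplied by `S.nz_of_fc_top _ hfc hT`.
[cite: GreenTao2010, §1, Def. 1.1 and App. C ("`∏_{j=1}^{s+1} ψ̇_i(e_j)` … is non-zero for
`i = 1`")] -/
theorem nz_of_fc_top (hk : 1 ≤ k) (hfc : S.FC) (hT : S.Top) : S.NZ := by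
  have h0 : S.c S.i₀ ≠ 0 := fun h => hT ⟨0, hk⟩ (by rw [h]; rfl)
  intro i hi
  by_cases hii : i = S.i₀
  · exact h0 (hii ▸ hi)
  · exact one_ne_zero (hfc i S.i₀ hii 1 0 (by rw [hi, smul_zero, zero_smul])).1

end SplitSys

end splitsys

/-! ### The `n = 0` average `A₀ = ‖ν‖_{U^k}^{2^k}` as a linear forms average -/

section azero

variable {k d' t : ℕ} (S : SplitSys k d' t)

/-- The system `{z + ∑_{j∈ω} a_j h_j : ω ⊆ [k]}` in the variables `(z, h) ∈ ℤ × ℤ^k` (the cube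
system behind `‖ν‖_{U^k}`). [cite: GreenTao2010, App. C (the forms `z + ∑ ω_j h_j`)] -/
def SplitSys.sysA₀ : IntFormSys (Finset (Fin k)) (Unit ⊕ Fin k) where
  coeff ω v := Sum.elim (fun _ => 1) (fun j => if j ∈ ω then S.c S.i₀ (Sum.inl j) else 0) v
  const _ := 0

/-- The forms of `sysA₀`: `z + ∑_{j∈ω} a_j h_j`. [folklore] -/
theorem SplitSys.sysA₀_evalZ {N' : ℕ} (ω : Finset (Fin k)) (v : Unit ⊕ Fin k → ZMod N') :
    S.sysA₀.evalZ N' ω v = v (Sum.inl ()) + ∑ j ∈ ω, S.a N' j * v (Sum.inr j) := by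
  unfold IntFormSys.evalZ SplitSys.sysA₀ SplitSys.a
  simp only [Fintype.sum_sum_type, Finset.univ_unique, Finset.sum_singleton, Sum.elim_inl,
    Sum.elim_inr, Int.cast_one, one_mul, Int.cast_zero, add_zero, Int.cast_ite, ite_mul, zero_mul,
    Finset.sum_ite_mem, Finset.univ_inter]

/-- `A₀` is the average of the majorant along `sysA₀`. [folklore] -/
theorem SplitSys.topA₀_eq {N' : ℕ} [NeZero N'] (ν₀ : ZMod N' → ℝ) :
    topA₀ ν₀ (S.a N') = 𝔼 v : Unit ⊕ Fin k → ZMod N', ∏ ω, ν₀ (S.sysA₀.evalZ N' ω v) := by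
  unfold topA₀ topV gowersProd
  rw [← expect_comp_equiv (Equiv.sumArrowEquivProdArrow Unit (Fin k) (ZMod N')).symm]
  rw [← expect_comp_equiv (Equiv.prodCongr (Equiv.funUnique Unit (ZMod N')).symm (Equiv.refl _))]
  refine Finset.expect_congr rfl fun q _ => Fintype.prod_congr _ _ fun ω => ?_
  rw [S.sysA₀_evalZ]
  rfl

/-- `sysA₀` has finite complexity (distinct `ω` give distinct `h`-supports).
[cite: GreenTao2010, App. C ("the `2^{s+1}` homogeneous forms `z + ∑ ω_j h_j` are pairwise
distinct")] -/
theorem SplitSys.sysA₀_fc (hT : S.Top) : S.sysA₀.FiniteComplexity := by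
  intro ω ω' hne a b hab
  have hz := congr_fun hab (Sum.inl ())
  simp only [SplitSys.sysA₀, Pi.smul_apply, Sum.elim_inl, smul_eq_mul, mul_one] at hz
  -- `a = b`; a coordinate where `ω, ω'` differ forces `a = 0`
  subst hz
  obtain ⟨j, hj⟩ : ∃ j, ¬ (j ∈ ω ↔ j ∈ ω') := by
    by_contra h
    push Not at h
    exact hne (Finset.ext h)
  have hj' := congr_fun hab (Sum.inr j)
  simp only [SplitSys.sysA₀, Pi.smul_apply, Sum.elim_inr, smul_eq_mul] at hj'
  have ha : a = 0 := by
    by_cases h1 : j ∈ ω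
    · have h2 : j ∉ ω' := fun h2 => hj ⟨fun _ => h2, fun _ => h1⟩
      rw [if_pos h1, if_neg h2, mul_zero] at hj'
      exact (mul_eq_zero.mp hj').resolve_right (hT j)
    · have h2 : j ∈ ω' := by
        by_contra h2; exact hj ⟨fun h => absurd h h1, fun h => absurd h h2⟩
      rw [if_neg h1, if_pos h2, mul_zero] at hj'
      exact (mul_eq_zero.mp hj'.symm).resolve_right (hT j)
  exact ⟨ha, ha⟩

/-- `sysA₀` is non-constant (the `z`-coefficient is `1`). [folklore] -/
theorem SplitSys.sysA₀_nz : S.sysA₀.Nonzero := by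
  intro ω h
  have := congr_fun h (Sum.inl ())
  simp [SplitSys.sysA₀] at this

/-- Coefficient bound for `sysA₀`. [folklore] -/
theorem SplitSys.sysA₀_bound {L : ℕ} (hL : 1 ≤ L) (hB : S.Bound L) : S.sysA₀.CoeffBound L := by
  intro ω v
  rcases v with _ | j
  · simp only [SplitSys.sysA₀, Sum.elim_inl, abs_one]; exact_mod_cast hL
  · simp only [SplitSys.sysA₀, Sum.elim_inr]
    split_ifs
    · exact hB _ _
    · simp

/-- **`A₀ = 1 + O(η)`**: under the `(D₀,D₀,D₀)`-linear forms condition with error `η`,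
`|A₀ - 1| ≤ η` once `D₀ ≥ 2^k, k + 1, L`. [cite: GreenTao2010, App. C ("This will follow from
the linear forms condition … the cases `n = 0, 1`")] -/
theorem SplitSys.abs_topA₀_sub_one_le {N' : ℕ} [NeZero N'] {D₀ L : ℕ} {η : ℝ} {ν₀ : ZMod N' → ℝ}
    (hLFC : LinearFormsCondition D₀ D₀ D₀ η ν₀) (hT : S.Top) (hL : 1 ≤ L) (hB : S.Bound L)
    (hLD : L ≤ D₀) (hk : 2 ^ k ≤ D₀) (hk' : k + 1 ≤ D₀) :
    |topA₀ ν₀ (S.a N') - 1| ≤ η := by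
  rw [S.topA₀_eq]
  refine S.sysA₀.abs_expect_prod_sub_one_le hLFC (S.sysA₀_fc hT) S.sysA₀_nz (S.sysA₀_bound hL hB)
    hLD ?_ ?_ ?_ ?_
  · rw [Fintype.card_finset, Fintype.card_fin]; exact Nat.one_le_two_pow
  · rwa [Fintype.card_finset, Fintype.card_fin]
  · rw [Fintype.card_sum, Fintype.card_unique, Fintype.card_fin]; omega
  · rw [Fintype.card_sum, Fintype.card_unique, Fintype.card_fin]; omega

end azero



/-! ### The lower weights and `A₁` as linear forms averages -/

section tb

variable {k d' t : ℕ} (S : SplitSys k d' t)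

/-- The lower-order weights `ν_B = ∏_{i : Ω(i) = B} ν(θ_i)` of App. C (`ν_{B,y}(x_B)`), as a family
on split points. [cite: GreenTao2010, App. C ("`ν_{B,y}(x_B) := ∏_{i : Ω(i) = B} ν(ψ_i(x_B,y))`")] -/
def SplitSys.νfam (N' : ℕ) (ν₀ : ZMod N' → ℝ) (B : Finset (SplitIdx k d'))
    (p : SplitIdx k d' → ZMod N') : ℝ :=
  ∏ i ∈ S.I B, ν₀ (S.θ N' i p)

/-- The index set of the system behind `‖ν_B‖_{□^B(ν)}^{2^{|B|}}`: triples `(C, ω, i)` with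
`ω ⊆ C ⊆ B`, `Ω(i) = C`. [cite: GreenTao2010, App. C (the expansion of the lower-weight estimate)] -/
def SplitSys.tbSig (B : Finset (SplitIdx k d')) :
    Finset (Σ _ : Finset (SplitIdx k d'), Finset (SplitIdx k d') × Fin t) :=
  B.powerset.sigma fun C => C.powerset ×ˢ S.I C

/-- Pairs of points as one function on `Bool × (coordinates)`. [folklore] -/
def pairEquiv (X : Type*) (ι : Type*) : (Bool × ι → X) ≃ ((ι → X) × (ι → X)) where
  toFun v := (fun c => v (false, c), fun c => v (true, c))
  invFun pp := fun bc => cond bc.1 (pp.2 bc.2) (pp.1 bc.2)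
  left_inv v := by funext ⟨b, c⟩; cases b <;> rfl
  right_inv pp := by ext <;> rfl

/-- The system behind `‖ν_B‖_{□^B(ν)}^{2^{|B|}}`: the forms `θ_i(x^{(ω)})` in the doubled variables
`(x⁽⁰⁾, x⁽¹⁾)` (coefficient `c_i(v)` on the copy prescribed by `ω`).
[cite: GreenTao2010, App. C ("the affine-linear forms `(x⁽⁰⁾_B, x⁽¹⁾_B, y) ↦ ψ_i(x^{(ω_C)}_C, y)`")] -/
def SplitSys.sysT (B : Finset (SplitIdx k d')) : IntFormSys (S.tbSig B) (Bool × SplitIdx k d') where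
  coeff φ bv := if (bv.2 ∈ φ.1.2.1 ↔ bv.1 = true) then S.c φ.1.2.2 bv.2 else 0
  const φ := S.κ φ.1.2.2

/-- The forms of `sysT B` are the `θ_i(x^{(ω)})`. [folklore] -/
theorem SplitSys.sysT_evalZ {N' : ℕ} (B : Finset (SplitIdx k d')) (φ : S.tbSig B)
    (v : Bool × SplitIdx k d' → ZMod N') :
    (S.sysT B).evalZ N' φ v =
      S.θ N' φ.1.2.2 (mixPt (pairEquiv (ZMod N') _ v).1 (pairEquiv (ZMod N') _ v).2 φ.1.2.1) := by
  unfold IntFormSys.evalZ SplitSys.sysT SplitSys.θ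
  congr 1
  rw [Fintype.sum_prod_type_right]
  refine Fintype.sum_congr _ _ fun c => ?_
  rw [Fintype.sum_bool]
  by_cases hc : c ∈ φ.1.2.1
  · simp [hc, mixPt, pairEquiv]
  · simp [hc, mixPt, pairEquiv]

/-- Nested products over `ω ⊆ C ⊆ B`, `i ∈ I(C)` as a product over `tbSig B`. [folklore] -/
theorem SplitSys.prod_tbSig (B : Finset (SplitIdx k d')) (F : Finset (SplitIdx k d') →
    Finset (SplitIdx k d') → Fin t → ℝ) :
    ∏ C ∈ B.powerset, ∏ ω ∈ C.powerset, ∏ i ∈ S.I C, F C ω i =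
      ∏ φ ∈ S.tbSig B, F φ.1 φ.2.1 φ.2.2 := by
  unfold SplitSys.tbSig
  rw [Finset.prod_sigma]
  refine Finset.prod_congr rfl fun C _ => ?_
  rw [Finset.prod_product]

/-- Merging the top factor of the weighted box power integrand: `(∏_{ω⊆B} ν_B) ∏_{C⊊B} ∏_ω ν_C =
∏_{C ⊆ B} ∏_ω ν_C`. [folklore] -/
theorem wBox_integrand_merge {ι X : Type*} [DecidableEq ι] (ν : Finset ι → (ι → X) → ℝ)
    (B : Finset ι) (pp : (ι → X) × (ι → X)) :
    (∏ ω ∈ B.powerset, ν B (mixPt pp.1 pp.2 ω)) *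
        ∏ C ∈ B.ssubsets, ∏ ω ∈ C.powerset, ν C (mixPt pp.1 pp.2 ω) =
      ∏ C ∈ B.powerset, ∏ ω ∈ C.powerset, ν C (mixPt pp.1 pp.2 ω) :=
  Finset.mul_prod_erase B.powerset (fun C => ∏ ω ∈ C.powerset, ν C (mixPt pp.1 pp.2 ω))
    (Finset.mem_powerset_self B)

/-- **`‖ν_B‖_{□^B(ν)}^{2^{|B|}}` is the average of the majorant along `sysT B`** (`B ⊆ A`).
[cite: GreenTao2010, App. C ("We expand the left-hand side, obtaining …")] -/
theorem SplitSys.wBoxPower_νfam_eq {N' : ℕ} [NeZero N'] (ν₀ : ZMod N' → ℝ)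
    (B : Finset (SplitIdx k d')) :
    wBoxPower (S.νfam N' ν₀) B (S.νfam N' ν₀ B) =
      𝔼 v : Bool × SplitIdx k d' → ZMod N', ∏ φ : S.tbSig B, ν₀ ((S.sysT B).evalZ N' φ v) := by
  unfold wBoxPower
  rw [← expect_comp_equiv (pairEquiv (ZMod N') (SplitIdx k d'))]
  refine Finset.expect_congr rfl fun v _ => ?_
  -- merge the `C = B` factor into the product over `C ⊆ B`
  rw [wBox_integrand_merge]
  unfold SplitSys.νfam
  rw [S.prod_tbSig B, ← Finset.prod_coe_sort]
  refine Fintype.prod_congr _ _ fun φ => ?_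
  rw [S.sysT_evalZ]

/-- Membership data of an index of `tbSig B`. [folklore] -/
theorem SplitSys.mem_tbSig {B : Finset (SplitIdx k d')}
    {φ : Σ _ : Finset (SplitIdx k d'), Finset (SplitIdx k d') × Fin t} (h : φ ∈ S.tbSig B) :
    φ.1 ⊆ B ∧ φ.2.1 ⊆ φ.1 ∧ S.Ω φ.2.2 = φ.1 := by
  unfold SplitSys.tbSig at h
  simp only [Finset.mem_sigma, Finset.mem_powerset, Finset.mem_product, SplitSys.I,
    Finset.mem_filter, Finset.mem_univ, true_and] at h
  exact ⟨h.1, h.2.1, h.2.2⟩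

/-- The recovery map: summing the coefficients of the two copies gives back `c_i`. [folklore] -/
theorem SplitSys.sysT_coeff_sum (B : Finset (SplitIdx k d')) (φ : S.tbSig B) (c : SplitIdx k d') :
    (S.sysT B).coeff φ (false, c) + (S.sysT B).coeff φ (true, c) = S.c φ.1.2.2 c := by
  unfold SplitSys.sysT
  by_cases hc : c ∈ φ.1.2.1 <;> simp [hc]

/-- `a • w = b • w` with `w ≠ 0` forces `a = b` over `ℤ`. [folklore] -/
theorem int_smul_cancel {ι : Type*} {w : ι → ℤ} (hw : w ≠ 0) {a b : ℤ} (h : a • w = b • w) :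
    a = b := by
  obtain ⟨c, hc⟩ : ∃ c, w c ≠ 0 := by
    by_contra h'
    push Not at h'
    exact hw (funext h')
  have := congr_fun h c
  simp only [Pi.smul_apply, smul_eq_mul] at this
  exact mul_right_cancel₀ hc this

/-- **Finite complexity of `sysT B`** ("as `C` varies over subsets of `B` and `i` varies over
those `i ∈ [t]` such that `Ω(i) = C`, [these forms] also have the property that no two forms are
affine-linear combinations of each other"). [cite: GreenTao2010, App. C (proof of the
lower-weight estimate)] -/
theorem SplitSys.sysT_fc (hfc : S.FC) (hnz : S.NZ) (B : Finset (SplitIdx k d')) :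
    (S.sysT B).FiniteComplexity := by
  intro φ φ' hne a b hab
  -- apply the recovery map
  have hrec : a • S.c φ.1.2.2 = b • S.c φ'.1.2.2 := by
    funext c
    have h0 := congr_fun hab (false, c)
    have h1 := congr_fun hab (true, c)
    simp only [Pi.smul_apply, smul_eq_mul] at h0 h1 ⊢
    rw [← S.sysT_coeff_sum B φ c, ← S.sysT_coeff_sum B φ' c, mul_add, mul_add, h0, h1]
  by_cases hi : φ.1.2.2 = φ'.1.2.2
  · -- same form `i`: then `C = C'`, `a = b`, and `ω ≠ ω'`
    obtain ⟨hCB, hωC, hΩ⟩ := S.mem_tbSig φ.2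
    obtain ⟨hCB', hωC', hΩ'⟩ := S.mem_tbSig φ'.2
    have hC : φ.1.1 = φ'.1.1 := by rw [← hΩ, ← hΩ', hi]
    rw [← hi] at hrec
    have hab' : a = b := int_smul_cancel (hnz _) hrec
    subst hab'
    have hω : φ.1.2.1 ≠ φ'.1.2.1 := by
      intro hω
      apply hne
      exact Subtype.ext (Sigma.ext hC (heq_of_eq (Prod.ext hω hi)))
    obtain ⟨c, hc⟩ : ∃ c, ¬ (c ∈ φ.1.2.1 ↔ c ∈ φ'.1.2.1) := by
      by_contra h
      push Not at h
      exact hω (Finset.ext h)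
    -- `c ∈ ω ∪ ω' ⊆ C = Ω(i)`, so `c_i(c) ≠ 0`
    have hcC : c ∈ S.Ω φ.1.2.2 := by
      rw [hΩ]
      rcases Decidable.em (c ∈ φ.1.2.1) with h | h
      · exact hωC h
      · have : c ∈ φ'.1.2.1 := by
          by_contra h'; exact hc ⟨fun x => absurd x h, fun x => absurd x h'⟩
        rw [hC]; exact hωC' this
    have hcne : S.c φ.1.2.2 c ≠ 0 := by
      obtain ⟨j, _, rfl⟩ := Finset.mem_map.mp hcC
      exact S.mem_Ω.mp hcC
    have h1 := congr_fun hab (true, c)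
    simp only [SplitSys.sysT, Pi.smul_apply, smul_eq_mul, iff_true] at h1
    rw [← hi] at h1
    have ha : a = 0 := by
      by_cases h : c ∈ φ.1.2.1
      · have h' : c ∉ φ'.1.2.1 := fun h' => hc ⟨fun _ => h', fun _ => h⟩
        rw [if_pos h, if_neg h', mul_zero] at h1
        exact (mul_eq_zero.mp h1).resolve_right hcne
      · have h' : c ∈ φ'.1.2.1 := by
          by_contra h'; exact hc ⟨fun x => absurd x h, fun x => absurd x h'⟩
        rw [if_neg h, if_pos h', mul_zero] at h1
        exact (mul_eq_zero.mp h1.symm).resolve_right hcne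
    exact ⟨ha, ha⟩
  · exact hfc _ _ hi a b hrec

/-- `sysT B` is non-constant. [folklore] -/
theorem SplitSys.sysT_nz (hnz : S.NZ) (B : Finset (SplitIdx k d')) : (S.sysT B).Nonzero := by
  intro φ h
  apply hnz φ.1.2.2
  funext c
  rw [← S.sysT_coeff_sum B φ c, h]
  simp

/-- Coefficient bound for `sysT B`. [folklore] -/
theorem SplitSys.sysT_bound {L : ℕ} (hB : S.Bound L) (B : Finset (SplitIdx k d')) :
    (S.sysT B).CoeffBound L := by
  intro φ bv
  unfold SplitSys.sysT
  dsimp only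
  split_ifs
  · exact hB _ _
  · simp

/-- The index set of `sysT B` has at most `4^k t` elements. [folklore] -/
theorem SplitSys.card_tbSig_le (B : Finset (SplitIdx k d')) (hB : B ⊆ privSet k d') :
    (S.tbSig B).card ≤ 2 ^ k * 2 ^ k * t := by
  unfold SplitSys.tbSig
  rw [Finset.card_sigma]
  have hBk : B.card ≤ k := (Finset.card_le_card hB).trans (le_of_eq card_privSet)
  calc ∑ C ∈ B.powerset, (C.powerset ×ˢ S.I C).card
      ≤ ∑ _C ∈ B.powerset, 2 ^ k * t := Finset.sum_le_sum fun C hC => by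
        rw [Finset.card_product, Finset.card_powerset]
        refine Nat.mul_le_mul (Nat.pow_le_pow_right (by norm_num)
          ((Finset.card_le_card (Finset.mem_powerset.mp hC)).trans hBk)) ?_
        exact (Finset.card_le_univ _).trans (by rw [Fintype.card_fin])
    _ = 2 ^ B.card * (2 ^ k * t) := by rw [Finset.sum_const, Finset.card_powerset, smul_eq_mul]
    _ ≤ 2 ^ k * (2 ^ k * t) := Nat.mul_le_mul_right _ (Nat.pow_le_pow_right (by norm_num) hBk)
    _ = 2 ^ k * 2 ^ k * t := by ring

/-- **`‖ν_B‖_{□^B(ν)}^{2^{|B|}} = 1 + O(η)` for `B ⊆ A`** (the lower-weight estimate of App. C, and,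
for `B = A`, the `n = 1` case `A₁`), under the `(D₀,D₀,D₀)`-linear forms condition with
`D₀ ≥ 4^k t, 2(k+d'), L`. [cite: GreenTao2010, App. C ("Thus (the lower-weight estimate) will
follow from the linear forms condition provided that the degree `D` of pseudorandomness is
sufficiently large")] -/
theorem SplitSys.abs_wBoxPower_νfam_sub_one_le {N' : ℕ} [NeZero N'] {D₀ L : ℕ} {η : ℝ}
    {ν₀ : ZMod N' → ℝ} (hLFC : LinearFormsCondition D₀ D₀ D₀ η ν₀) (hη : 0 ≤ η)
    (hfc : S.FC) (hnz : S.NZ) (hB : S.Bound L) (hLD : L ≤ D₀)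
    (hD1 : 2 ^ k * 2 ^ k * t ≤ D₀) (hD2 : 2 * (k + d') ≤ D₀) (hkd : 1 ≤ k + d')
    (B : Finset (SplitIdx k d')) (hBA : B ⊆ privSet k d') :
    |wBoxPower (S.νfam N' ν₀) B (S.νfam N' ν₀ B) - 1| ≤ η := by
  rw [S.wBoxPower_νfam_eq ν₀ B]
  rcases (S.tbSig B).eq_empty_or_nonempty with h0 | hne
  · -- no forms: the average is `1`
    have : ∀ v : Bool × SplitIdx k d' → ZMod N', ∏ φ : S.tbSig B, ν₀ ((S.sysT B).evalZ N' φ v) = 1 :=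
      fun v => by
        haveI : IsEmpty (S.tbSig B) := by rw [h0]; infer_instance
        exact Fintype.prod_empty _
    simp_rw [this]
    rw [Fintype.expect_const, sub_self, abs_zero]
    exact hη
  · refine (S.sysT B).abs_expect_prod_sub_one_le hLFC (S.sysT_fc hfc hnz B) (S.sysT_nz hnz B)
      (S.sysT_bound hB B) hLD ?_ ?_ ?_ ?_
    · rw [Fintype.card_coe]; exact hne.card_pos
    · rw [Fintype.card_coe]; exact (S.card_tbSig_le B hBA).trans hD1
    · rw [Fintype.card_prod, Fintype.card_bool, Fintype.card_sum, Fintype.card_fin,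
        Fintype.card_fin]; omega
    · rw [Fintype.card_prod, Fintype.card_bool, Fintype.card_sum, Fintype.card_fin,
        Fintype.card_fin]; omega

end tb



/-! ### The `n = 2` average `A₂` as a linear forms average -/

section atwo

variable {k d' t : ℕ} (S : SplitSys k d' t) (hk : 1 ≤ k)

/-- Index type of the fibre coordinates `r = (u, y⁰, y¹)`. [folklore] -/
abbrev RIdx (k d' : ℕ) := Fin k ⊕ (Fin d' ⊕ Fin d')

/-- Index type of the variables of the sextuple average: `(z, h)` and two copies of `r`.
[cite: GreenTao2010, App. C ("the average `𝔼_*` is over all sextuples")] -/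
abbrev A₂Idx (k d' : ℕ) := (Unit ⊕ Fin k) ⊕ (Bool × RIdx k d')

/-- Fibre coordinates as a function on `RIdx`. [folklore] -/
def rOfFun {X : Type*} (w : RIdx k d' → X) : (Fin k → X) × (Fin d' → X) × (Fin d' → X) :=
  (fun j => w (Sum.inl j), fun m => w (Sum.inr (Sum.inl m)), fun m => w (Sum.inr (Sum.inr m)))

/-- The variables `(z, h, r, r')` as a function on `A₂Idx`. [folklore] -/
def a₂Equiv (X : Type*) (k d' : ℕ) : (A₂Idx k d' → X) ≃
    ((X × (Fin k → X)) × (((Fin k → X) × (Fin d' → X) × (Fin d' → X)) ×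
      ((Fin k → X) × (Fin d' → X) × (Fin d' → X)))) where
  toFun v := ((v (Sum.inl (Sum.inl ())), fun j => v (Sum.inl (Sum.inr j))),
    (rOfFun (fun i => v (Sum.inr (false, i))), rOfFun (fun i => v (Sum.inr (true, i)))))
  invFun q := Sum.elim (Sum.elim (fun _ => q.1.1) q.1.2) fun bi =>
    cond bi.1 (Sum.elim q.2.2.1 (Sum.elim q.2.2.2.1 q.2.2.2.2) bi.2)
      (Sum.elim q.2.1.1 (Sum.elim q.2.1.2.1 q.2.1.2.2) bi.2)
  left_inv v := by
    funext i
    rcases i with (u | j) | ⟨b, ri⟩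
    · rfl
    · rfl
    · cases b <;> rcases ri with j | m | m <;> rfl
  right_inv q := by rfl

/-- The index set of the lower weight `W`: triples `(C, ω, i)` with `ω ⊆ C ⊊ A`, `Ω(i) = C`.
[cite: GreenTao2010, App. C (the definition of `W(z,h)`)] -/
def SplitSys.lowSig : Finset (Σ _ : Finset (SplitIdx k d'), Finset (SplitIdx k d') × Fin t) :=
  (privSet k d').ssubsets.sigma fun C => C.powerset ×ˢ S.I C

/-- Membership data of an index of `lowSig`. [folklore] -/
theorem SplitSys.mem_lowSig {φ : Σ _ : Finset (SplitIdx k d'), Finset (SplitIdx k d') × Fin t}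
    (h : φ ∈ S.lowSig) : φ.1 ⊂ privSet k d' ∧ φ.2.1 ⊆ φ.1 ∧ S.Ω φ.2.2 = φ.1 := by
  unfold SplitSys.lowSig at h
  simp only [Finset.mem_sigma, Finset.mem_ssubsets, Finset.mem_powerset, Finset.mem_product,
    SplitSys.I, Finset.mem_filter, Finset.mem_univ, true_and] at h
  exact ⟨h.1, h.2.1, h.2.2⟩

/-- The lower weight as a product over `lowSig`. [folklore] -/
theorem SplitSys.topWeight_νfam_eq {N' : ℕ} (ν₀ : ZMod N' → ℝ)
    (pp : (SplitIdx k d' → ZMod N') × (SplitIdx k d' → ZMod N')) :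
    topWeight (S.νfam N' ν₀) pp = ∏ φ ∈ S.lowSig, ν₀ (S.θ N' φ.2.2 (mixPt pp.1 pp.2 φ.2.1)) := by
  unfold topWeight SplitSys.νfam SplitSys.lowSig
  rw [Finset.prod_sigma]
  refine Finset.prod_congr rfl fun C _ => ?_
  rw [Finset.prod_product]

/-- The system behind the sextuple average `A₂`, after dilating all variables by the pivot
coefficient `α = a_{pivot}` to clear the denominator `α⁻¹` coming from solving the constraint
`z = b₀(y⁰) + ∑ a_j x_j⁽⁰⁾` for the pivot coordinate ("substitute for `x_{s+1}^{(0)}` … in terms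
of the other variables"; "one can clear denominators"): forms `α(z + ∑_{j∈ω} a_j h_j)`
(indexed by `ω`) and, for each copy `ρ` of the fibre coordinates and each `(C, ω, i)` of the
lower weight, the form `θ_i(x^{(ω)})` expressed in `(z, h, u_ρ, y⁰_ρ)` — the "slightly alarming
expression" of App. C. The integer `ai` is a lift of `α⁻¹ (mod N')` and only enters the
constants. [cite: GreenTao2010, App. C (the sextuple average, the constraints, and the
"slightly alarming expression")] -/
def SplitSys.sysA₂ (ai : ℤ) : IntFormSys (Finset (Fin k) ⊕ (Bool × S.lowSig)) (A₂Idx k d') where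
  coeff φ :=
    match φ with
    | Sum.inl ω =>
      Sum.elim (Sum.elim (fun _ => S.c S.i₀ (Sum.inl (pivot hk)))
        (fun j => if j ∈ ω then S.c S.i₀ (Sum.inl (pivot hk)) * S.c S.i₀ (Sum.inl j) else 0))
        (fun _ => 0)
    | Sum.inr (ρ, φ) =>
      Sum.elim (Sum.elim (fun _ => S.c φ.1.2.2 (Sum.inl (pivot hk)))
        (fun j => if Sum.inl j ∈ φ.1.2.1 then
          S.c S.i₀ (Sum.inl (pivot hk)) * S.c φ.1.2.2 (Sum.inl j) else 0))
        (fun bi => if bi.1 = ρ then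
          Sum.elim (fun j => if j = pivot hk then 0 else
              S.c S.i₀ (Sum.inl (pivot hk)) * S.c φ.1.2.2 (Sum.inl j) -
                S.c φ.1.2.2 (Sum.inl (pivot hk)) * S.c S.i₀ (Sum.inl j))
            (Sum.elim (fun m => S.c S.i₀ (Sum.inl (pivot hk)) * S.c φ.1.2.2 (Sum.inr m) -
                S.c φ.1.2.2 (Sum.inl (pivot hk)) * S.c S.i₀ (Sum.inr m))
              (fun _ => 0)) bi.2
          else 0)
  const φ :=
    match φ with
    | Sum.inl _ => 0
    | Sum.inr (_, φ) => S.κ φ.1.2.2 - S.c φ.1.2.2 (Sum.inl (pivot hk)) * ai * S.κ S.i₀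

/-- The value of the general form at a split point, separated into private and other
coordinates. [folklore] -/
theorem SplitSys.θ_eq_sum {N' : ℕ} (i : Fin t) (p : SplitIdx k d' → ZMod N') :
    S.θ N' i p = ∑ j, (S.c i (Sum.inl j) : ZMod N') * p (Sum.inl j) +
      ∑ m, (S.c i (Sum.inr m) : ZMod N') * p (Sum.inr m) + (S.κ i : ZMod N') := by
  unfold SplitSys.θ
  rw [Fintype.sum_sum_type]

/-- The coordinates of the fibre point. [folklore] -/
theorem fibrePoint_apply {N' : ℕ} (a : Fin k → ZMod N') (ainv : ZMod N')
    (b₀ : (Fin d' → ZMod N') → ZMod N') (z : ZMod N')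
    (r : (Fin k → ZMod N') × (Fin d' → ZMod N') × (Fin d' → ZMod N')) (j : Fin k) :
    fibrePoint hk a ainv b₀ z r j = if j = pivot hk then
      ainv * (z - b₀ r.2.1 - ∑ j' ∈ Finset.univ.erase (pivot hk), a j' * r.1 j') else r.1 j := by
  unfold fibrePoint
  by_cases hj : j = pivot hk
  · subst hj; simp
  · rw [Function.update_of_ne hj, if_neg hj]

end atwo



section atwoeval

variable {k d' t : ℕ} (S : SplitSys k d' t) (hk : 1 ≤ k) {N' : ℕ}

/-- The top forms of `sysA₂`: `α z + ∑_{j∈ω} a_j (α h_j)`. [folklore] -/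
theorem SplitSys.sysA₂_evalZ_inl (ai : ℤ) (ω : Finset (Fin k)) (v : A₂Idx k d' → ZMod N') :
    (S.sysA₂ hk ai).evalZ N' (Sum.inl ω) v =
      S.a N' (pivot hk) * v (Sum.inl (Sum.inl ())) +
        ∑ j ∈ ω, S.a N' j * (S.a N' (pivot hk) * v (Sum.inl (Sum.inr j))) := by
  unfold IntFormSys.evalZ SplitSys.sysA₂ SplitSys.a
  simp only [Fintype.sum_sum_type, Finset.univ_unique, Finset.sum_singleton, Sum.elim_inl,
    Sum.elim_inr, Int.cast_zero, zero_mul, Finset.sum_const_zero, add_zero, Int.cast_ite,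
    Int.cast_mul, ite_mul, Finset.sum_ite_mem, Finset.univ_inter]
  congr 1
  exact Finset.sum_congr rfl fun j _ => by ring

/-- Sums with the pivot term removed. [folklore] -/
theorem sum_ite_pivot (T : Fin k → ZMod N') :
    ∑ j, (if j = pivot hk then 0 else T j) = ∑ j ∈ Finset.univ.erase (pivot hk), T j := by
  rw [← Finset.add_sum_erase Finset.univ _ (Finset.mem_univ (pivot hk)), if_pos rfl, zero_add]
  exact Finset.sum_congr rfl fun j hj => if_neg (Finset.ne_of_mem_erase hj)

/-- The explicit value of the lower forms ("the slightly alarming expression"), in the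
variables `z, h, u, y⁰` of one fibre copy. [cite: GreenTao2010, App. C] -/
def SplitSys.lowExplicit (ainv : ZMod N') (i : Fin t) (ω : Finset (SplitIdx k d')) (z : ZMod N')
    (h u : Fin k → ZMod N') (y₀ : Fin d' → ZMod N') : ZMod N' :=
  (S.c i (Sum.inl (pivot hk)) : ZMod N') * z +
    (∑ j, if Sum.inl j ∈ ω then S.a N' (pivot hk) * (S.c i (Sum.inl j) : ZMod N') * h j else 0) +
    (∑ j ∈ Finset.univ.erase (pivot hk), S.a N' (pivot hk) * (S.c i (Sum.inl j) : ZMod N') * u j) -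
    (S.c i (Sum.inl (pivot hk)) : ZMod N') * (∑ j ∈ Finset.univ.erase (pivot hk), S.a N' j * u j) +
    (∑ m, S.a N' (pivot hk) * (S.c i (Sum.inr m) : ZMod N') * y₀ m) -
    (S.c i (Sum.inl (pivot hk)) : ZMod N') * (∑ m, (S.c S.i₀ (Sum.inr m) : ZMod N') * y₀ m) +
    (S.κ i : ZMod N') - (S.c i (Sum.inl (pivot hk)) : ZMod N') * ainv * (S.κ S.i₀ : ZMod N')

/-- The lower forms of `sysA₂` evaluate to `lowExplicit`. [folklore] -/
theorem SplitSys.sysA₂_evalZ_inr {ainv : ZMod N'} {ai : ℤ} (hai : (ai : ZMod N') = ainv) (ρ : Bool)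
    (φ : S.lowSig) (v : A₂Idx k d' → ZMod N') :
    (S.sysA₂ hk ai).evalZ N' (Sum.inr (ρ, φ)) v =
      S.lowExplicit hk ainv φ.1.2.2 φ.1.2.1 (v (Sum.inl (Sum.inl ())))
        (fun j => v (Sum.inl (Sum.inr j))) (fun j => v (Sum.inr (ρ, Sum.inl j)))
        (fun m => v (Sum.inr (ρ, Sum.inr (Sum.inl m)))) := by
  unfold IntFormSys.evalZ SplitSys.sysA₂ SplitSys.lowExplicit SplitSys.a
  simp only [Fintype.sum_sum_type, Fintype.sum_prod_type, Fintype.sum_bool, Finset.univ_unique,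
    Finset.sum_singleton, Sum.elim_inl, Sum.elim_inr]
  cases ρ <;>
  · simp only [if_true, if_false, Bool.false_eq_true, Bool.true_eq_false, Int.cast_zero,
      zero_mul, Finset.sum_const_zero, add_zero, zero_add, Int.cast_ite, Int.cast_mul,
      Int.cast_sub, ite_mul, hai]
    rw [sum_ite_pivot hk]
    have hu : ∀ (s : Finset (Fin k)) (u : Fin k → ZMod N'),
        ∑ j ∈ s, ((S.c S.i₀ (Sum.inl (pivot hk)) : ZMod N') * S.c φ.1.2.2 (Sum.inl j) -
          S.c φ.1.2.2 (Sum.inl (pivot hk)) * S.c S.i₀ (Sum.inl j)) * u j =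
        (∑ j ∈ s, (S.c S.i₀ (Sum.inl (pivot hk)) : ZMod N') * S.c φ.1.2.2 (Sum.inl j) * u j) -
          S.c φ.1.2.2 (Sum.inl (pivot hk)) * ∑ j ∈ s, (S.c S.i₀ (Sum.inl j) : ZMod N') * u j := by
      intro s u
      rw [Finset.mul_sum, ← Finset.sum_sub_distrib]
      exact Finset.sum_congr rfl fun j _ => by ring
    have hy : ∀ y : Fin d' → ZMod N',
        ∑ m, ((S.c S.i₀ (Sum.inl (pivot hk)) : ZMod N') * S.c φ.1.2.2 (Sum.inr m) -
          S.c φ.1.2.2 (Sum.inl (pivot hk)) * S.c S.i₀ (Sum.inr m)) * y m =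
        (∑ m, (S.c S.i₀ (Sum.inl (pivot hk)) : ZMod N') * S.c φ.1.2.2 (Sum.inr m) * y m) -
          S.c φ.1.2.2 (Sum.inl (pivot hk)) * ∑ m, (S.c S.i₀ (Sum.inr m) : ZMod N') * y m := by
      intro y
      rw [Finset.mul_sum, ← Finset.sum_sub_distrib]
      exact Finset.sum_congr rfl fun m _ => by ring
    rw [hu, hy]
    have hh : ∀ h : Fin k → ZMod N', ∑ j, (if Sum.inl j ∈ φ.1.2.1 then
        ((S.c S.i₀ (Sum.inl (pivot hk)) : ZMod N') * S.c φ.1.2.2 (Sum.inl j)) * h j else 0) =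
        ∑ j, (if Sum.inl j ∈ φ.1.2.1 then
          (S.c S.i₀ (Sum.inl (pivot hk)) : ZMod N') * S.c φ.1.2.2 (Sum.inl j) * h j else 0) :=
      fun h => rfl
    ring

end atwoeval

end Literature.NumberTheory.Sieve

namespace Literature.NumberTheory.Sieve

section atwotheta

variable {k d' t : ℕ} (S : SplitSys k d' t) (hk : 1 ≤ k) {N' : ℕ}

/-- **The lower forms at the dilated parametrised pair are `lowExplicit`** (the computation
behind the "slightly alarming expression": substitute the pivot coordinate and dilate).
[cite: GreenTao2010, App. C (the "slightly alarming expression")] -/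
theorem SplitSys.θ_mixPt_topParam_dilate {ainv : ZMod N'} (hainv : S.a N' (pivot hk) * ainv = 1)
    (i : Fin t) (ω : Finset (SplitIdx k d')) (hω : ∀ m, Sum.inr m ∉ ω) (z : ZMod N')
    (h u : Fin k → ZMod N') (y₀ y₁ : Fin d' → ZMod N') :
    S.θ N' i (mixPt
      (topParam hk (S.a N') ainv (S.b₀ N') (S.a N' (pivot hk) * z, fun j => S.a N' (pivot hk) * h j)
        (fun j => S.a N' (pivot hk) * u j, fun m => S.a N' (pivot hk) * y₀ m,
          fun m => S.a N' (pivot hk) * y₁ m)).1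
      (topParam hk (S.a N') ainv (S.b₀ N') (S.a N' (pivot hk) * z, fun j => S.a N' (pivot hk) * h j)
        (fun j => S.a N' (pivot hk) * u j, fun m => S.a N' (pivot hk) * y₀ m,
          fun m => S.a N' (pivot hk) * y₁ m)).2 ω) =
      S.lowExplicit hk ainv i ω z h u y₀ := by
  have hainv' : ainv * S.a N' (pivot hk) = 1 := by rw [mul_comm]; exact hainv
  -- the fibre point at the dilated variables
  have hFP : ∀ j, fibrePoint hk (S.a N') ainv (S.b₀ N') (S.a N' (pivot hk) * z)
      (fun j => S.a N' (pivot hk) * u j, fun m => S.a N' (pivot hk) * y₀ m,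
        fun m => S.a N' (pivot hk) * y₁ m) j =
      if j = pivot hk then z - ainv * S.b₀ N' (fun m => S.a N' (pivot hk) * y₀ m) -
        ∑ j' ∈ Finset.univ.erase (pivot hk), S.a N' j' * u j' else S.a N' (pivot hk) * u j := by
    intro j
    rw [fibrePoint_apply]
    split_ifs with hj
    · dsimp only
      have : ∑ j' ∈ Finset.univ.erase (pivot hk), S.a N' j' * (S.a N' (pivot hk) * u j') =
          S.a N' (pivot hk) * ∑ j' ∈ Finset.univ.erase (pivot hk), S.a N' j' * u j' := by
        rw [Finset.mul_sum]; exact Finset.sum_congr rfl fun _ _ => by ring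
      rw [this]
      linear_combination (z - ∑ j' ∈ Finset.univ.erase (pivot hk), S.a N' j' * u j') * hainv'
    · rfl
  -- the mixed point
  have hinr : ∀ m, mixPt
      (topParam hk (S.a N') ainv (S.b₀ N') (S.a N' (pivot hk) * z, fun j => S.a N' (pivot hk) * h j)
        (fun j => S.a N' (pivot hk) * u j, fun m => S.a N' (pivot hk) * y₀ m,
          fun m => S.a N' (pivot hk) * y₁ m)).1
      (topParam hk (S.a N') ainv (S.b₀ N') (S.a N' (pivot hk) * z, fun j => S.a N' (pivot hk) * h j)
        (fun j => S.a N' (pivot hk) * u j, fun m => S.a N' (pivot hk) * y₀ m,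
          fun m => S.a N' (pivot hk) * y₁ m)).2 ω (Sum.inr m) = S.a N' (pivot hk) * y₀ m := by
    intro m
    rw [mixPt_of_not_mem (hω m)]
    rfl
  have hinl : ∀ j, mixPt
      (topParam hk (S.a N') ainv (S.b₀ N') (S.a N' (pivot hk) * z, fun j => S.a N' (pivot hk) * h j)
        (fun j => S.a N' (pivot hk) * u j, fun m => S.a N' (pivot hk) * y₀ m,
          fun m => S.a N' (pivot hk) * y₁ m)).1
      (topParam hk (S.a N') ainv (S.b₀ N') (S.a N' (pivot hk) * z, fun j => S.a N' (pivot hk) * h j)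
        (fun j => S.a N' (pivot hk) * u j, fun m => S.a N' (pivot hk) * y₀ m,
          fun m => S.a N' (pivot hk) * y₁ m)).2 ω (Sum.inl j) =
      (if j = pivot hk then z - ainv * S.b₀ N' (fun m => S.a N' (pivot hk) * y₀ m) -
          ∑ j' ∈ Finset.univ.erase (pivot hk), S.a N' j' * u j' else S.a N' (pivot hk) * u j) +
        (if Sum.inl j ∈ ω then S.a N' (pivot hk) * h j else 0) := by
    intro j
    by_cases hj : Sum.inl j ∈ ω
    · rw [mixPt_of_mem hj, if_pos hj, ← hFP j]
      rfl
    · rw [mixPt_of_not_mem hj, if_neg hj, add_zero, ← hFP j]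
      rfl
  rw [S.θ_eq_sum]
  simp_rw [hinr]
  rw [Fintype.sum_congr _ _ fun j => by rw [hinl]]
  -- now everything is explicit: separate the pivot term
  have hsplit : ∀ (X : ZMod N') (U V : Fin k → ZMod N'),
      ∑ j, (S.c i (Sum.inl j) : ZMod N') * ((if j = pivot hk then X else U j) + V j) =
        (S.c i (Sum.inl (pivot hk)) : ZMod N') * X +
          ∑ j ∈ Finset.univ.erase (pivot hk), (S.c i (Sum.inl j) : ZMod N') * U j +
          ∑ j, (S.c i (Sum.inl j) : ZMod N') * V j := by
    intro X U V
    simp only [mul_add, Finset.sum_add_distrib]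
    rw [← Finset.add_sum_erase Finset.univ _ (Finset.mem_univ (pivot hk)), if_pos rfl]
    congr 2
    exact Finset.sum_congr rfl fun j hj => by rw [if_neg (Finset.ne_of_mem_erase hj)]
  rw [hsplit]
  unfold SplitSys.lowExplicit SplitSys.b₀
  -- `ainv (∑ c (α y) + κ₀) = ∑ c y + ainv κ₀`
  have hb : ainv * (∑ m, (S.c S.i₀ (Sum.inr m) : ZMod N') * (S.a N' (pivot hk) * y₀ m) +
      (S.κ S.i₀ : ZMod N')) = (∑ m, (S.c S.i₀ (Sum.inr m) : ZMod N') * y₀ m) + ainv * S.κ S.i₀ := by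
    rw [mul_add, Finset.mul_sum]
    congr 1
    exact Finset.sum_congr rfl fun m _ => by
      linear_combination ((S.c S.i₀ (Sum.inr m) : ZMod N') * y₀ m) * hainv'
  rw [hb]
  have h1 : ∑ j, (S.c i (Sum.inl j) : ZMod N') * (if Sum.inl j ∈ ω then S.a N' (pivot hk) * h j else 0)
      = ∑ j, (if Sum.inl j ∈ ω then S.a N' (pivot hk) * (S.c i (Sum.inl j) : ZMod N') * h j else 0) :=
    Finset.sum_congr rfl fun j _ => by split_ifs <;> ring
  have h2 : ∑ j ∈ Finset.univ.erase (pivot hk), (S.c i (Sum.inl j) : ZMod N') * (S.a N' (pivot hk) * u j)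
      = ∑ j ∈ Finset.univ.erase (pivot hk), S.a N' (pivot hk) * (S.c i (Sum.inl j) : ZMod N') * u j :=
    Finset.sum_congr rfl fun j _ => by ring
  have h3 : ∑ m, (S.c i (Sum.inr m) : ZMod N') * (S.a N' (pivot hk) * y₀ m)
      = ∑ m, S.a N' (pivot hk) * (S.c i (Sum.inr m) : ZMod N') * y₀ m :=
    Finset.sum_congr rfl fun m _ => by ring
  rw [h1, h2, h3]
  unfold SplitSys.a
  ring

end atwotheta



section atwoexp

variable {k d' t : ℕ} (S : SplitSys k d' t) (hk : 1 ≤ k) {N' : ℕ} [NeZero N']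

omit [NeZero N'] in
/-- The lower weight at a dilated parametrised pair as the product of the lower forms of
`sysA₂`. [folklore] -/
theorem SplitSys.topWeight_dilate_eq {ainv : ZMod N'} (hainv : S.a N' (pivot hk) * ainv = 1)
    {ai : ℤ} (hai : (ai : ZMod N') = ainv) (ν₀ : ZMod N' → ℝ) (ρ : Bool) (v : A₂Idx k d' → ZMod N') :
    topWeight (S.νfam N' ν₀)
      (topParam hk (S.a N') ainv (S.b₀ N')
        (S.a N' (pivot hk) * v (Sum.inl (Sum.inl ())), fun j => S.a N' (pivot hk) * v (Sum.inl (Sum.inr j)))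
        (fun j => S.a N' (pivot hk) * v (Sum.inr (ρ, Sum.inl j)),
          fun m => S.a N' (pivot hk) * v (Sum.inr (ρ, Sum.inr (Sum.inl m))),
          fun m => S.a N' (pivot hk) * v (Sum.inr (ρ, Sum.inr (Sum.inr m))))) =
      ∏ φ : S.lowSig, ν₀ ((S.sysA₂ hk ai).evalZ N' (Sum.inr (ρ, φ)) v) := by
  rw [S.topWeight_νfam_eq, ← Finset.prod_coe_sort]
  refine Fintype.prod_congr _ _ fun φ => ?_
  obtain ⟨_, hωC, hΩ⟩ := S.mem_lowSig φ.2
  have hω : ∀ m, Sum.inr m ∉ φ.1.2.1 := fun m hm =>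
    S.inr_not_mem_Ω φ.1.2.2 m (by rw [hΩ]; exact hωC hm)
  rw [S.θ_mixPt_topParam_dilate hk hainv _ _ hω, S.sysA₂_evalZ_inr hk hai]

/-- **`A₂` is the average of the majorant along `sysA₂`** (dilating all the free variables of the
sextuple average by the unit `α`). [cite: GreenTao2010, App. C (the sextuple average; "one can
clear denominators and reduce back to estimates involving only bounded integers")] -/
theorem SplitSys.topA₂_eq (hunit : IsUnit (S.a N' (pivot hk))) {ainv : ZMod N'}
    (hainv : S.a N' (pivot hk) * ainv = 1) {ai : ℤ} (hai : (ai : ZMod N') = ainv)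
    (ν₀ : ZMod N' → ℝ) :
    topA₂ hk ν₀ (S.a N') ainv (S.b₀ N') (S.νfam N' ν₀) =
      𝔼 v : A₂Idx k d' → ZMod N', ∏ φ, ν₀ ((S.sysA₂ hk ai).evalZ N' φ v) := by
  unfold topA₂
  -- merge the three averages and reindex by `a₂Equiv`
  have hmerge : (𝔼 q : ZMod N' × (Fin k → ZMod N'), 𝔼 r : FibreCoords N' k d',
      𝔼 r' : FibreCoords N' k d', topV ν₀ (S.a N') q *
        topWeight (S.νfam N' ν₀) (topParam hk (S.a N') ainv (S.b₀ N') q r) *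
        topWeight (S.νfam N' ν₀) (topParam hk (S.a N') ainv (S.b₀ N') q r')) =
      𝔼 x : (ZMod N' × (Fin k → ZMod N')) × (FibreCoords N' k d' × FibreCoords N' k d'),
        topV ν₀ (S.a N') x.1 *
          topWeight (S.νfam N' ν₀) (topParam hk (S.a N') ainv (S.b₀ N') x.1 x.2.1) *
          topWeight (S.νfam N' ν₀) (topParam hk (S.a N') ainv (S.b₀ N') x.1 x.2.2) := by
    have hinner : ∀ q : ZMod N' × (Fin k → ZMod N'), (𝔼 r : FibreCoords N' k d',
        𝔼 r' : FibreCoords N' k d', topV ν₀ (S.a N') q *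
          topWeight (S.νfam N' ν₀) (topParam hk (S.a N') ainv (S.b₀ N') q r) *
          topWeight (S.νfam N' ν₀) (topParam hk (S.a N') ainv (S.b₀ N') q r')) =
        𝔼 rr : FibreCoords N' k d' × FibreCoords N' k d', topV ν₀ (S.a N') q *
          topWeight (S.νfam N' ν₀) (topParam hk (S.a N') ainv (S.b₀ N') q rr.1) *
          topWeight (S.νfam N' ν₀) (topParam hk (S.a N') ainv (S.b₀ N') q rr.2) := fun q =>
      expect_expect_eq_expect_prod (fun (r r' : FibreCoords N' k d') => topV ν₀ (S.a N') q *
          topWeight (S.νfam N' ν₀) (topParam hk (S.a N') ainv (S.b₀ N') q r) *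
          topWeight (S.νfam N' ν₀) (topParam hk (S.a N') ainv (S.b₀ N') q r'))
    simp_rw [hinner]
    exact expect_expect_eq_expect_prod (fun (q : ZMod N' × (Fin k → ZMod N'))
      (rr : FibreCoords N' k d' × FibreCoords N' k d') => topV ν₀ (S.a N') q *
          topWeight (S.νfam N' ν₀) (topParam hk (S.a N') ainv (S.b₀ N') q rr.1) *
          topWeight (S.νfam N' ν₀) (topParam hk (S.a N') ainv (S.b₀ N') q rr.2))
  rw [hmerge, ← expect_comp_equiv (a₂Equiv (ZMod N') k d')]
  -- dilate all variables by `α`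
  rw [← expect_pi_unit_mul (fun v : A₂Idx k d' → ZMod N' =>
    topV ν₀ (S.a N') (a₂Equiv (ZMod N') k d' v).1 *
      topWeight (S.νfam N' ν₀) (topParam hk (S.a N') ainv (S.b₀ N')
        (a₂Equiv (ZMod N') k d' v).1 (a₂Equiv (ZMod N') k d' v).2.1) *
      topWeight (S.νfam N' ν₀) (topParam hk (S.a N') ainv (S.b₀ N')
        (a₂Equiv (ZMod N') k d' v).1 (a₂Equiv (ZMod N') k d' v).2.2))
    (a := fun _ => S.a N' (pivot hk)) fun _ => hunit]
  refine Finset.expect_congr rfl fun v _ => ?_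
  -- identify the three factors
  rw [Fintype.prod_sum_type, Fintype.prod_prod_type, Fintype.prod_bool]
  have htop : topV ν₀ (S.a N') (a₂Equiv (ZMod N') k d' (fun c => S.a N' (pivot hk) * v c)).1 =
      ∏ ω : Finset (Fin k), ν₀ ((S.sysA₂ hk ai).evalZ N' (Sum.inl ω) v) := by
    unfold topV gowersProd
    refine Fintype.prod_congr _ _ fun ω => ?_
    rw [S.sysA₂_evalZ_inl]
    rfl
  have hr := S.topWeight_dilate_eq hk hainv hai ν₀ false v
  have hr' := S.topWeight_dilate_eq hk hainv hai ν₀ true v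
  rw [htop]
  show (∏ ω : Finset (Fin k), ν₀ ((S.sysA₂ hk ai).evalZ N' (Sum.inl ω) v)) *
      topWeight (S.νfam N' ν₀) (topParam hk (S.a N') ainv (S.b₀ N')
        (S.a N' (pivot hk) * v (Sum.inl (Sum.inl ())), fun j => S.a N' (pivot hk) * v (Sum.inl (Sum.inr j)))
        (fun j => S.a N' (pivot hk) * v (Sum.inr (false, Sum.inl j)),
          fun m => S.a N' (pivot hk) * v (Sum.inr (false, Sum.inr (Sum.inl m))),
          fun m => S.a N' (pivot hk) * v (Sum.inr (false, Sum.inr (Sum.inr m))))) *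
      topWeight (S.νfam N' ν₀) (topParam hk (S.a N') ainv (S.b₀ N')
        (S.a N' (pivot hk) * v (Sum.inl (Sum.inl ())), fun j => S.a N' (pivot hk) * v (Sum.inl (Sum.inr j)))
        (fun j => S.a N' (pivot hk) * v (Sum.inr (true, Sum.inl j)),
          fun m => S.a N' (pivot hk) * v (Sum.inr (true, Sum.inr (Sum.inl m))),
          fun m => S.a N' (pivot hk) * v (Sum.inr (true, Sum.inr (Sum.inr m))))) = _
  rw [hr, hr']
  ring

end atwoexp



section atwofc

variable {k d' t : ℕ} (S : SplitSys k d' t) (hk : 1 ≤ k)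

/-- The recovery map of copy `ρ`: a `ℤ`-linear map from coefficient vectors of `sysA₂` to
coefficient vectors of the split system, inverting the substitution of the pivot coordinate
("the set `C` from which the form came may be identified knowing only `r₁,…,r_s,r'`").
[cite: GreenTao2010, App. C (proof that the forms of the sextuple average are pairwise
non-parallel)] -/
def SplitSys.recov (ρ : Bool) (w : A₂Idx k d' → ℤ) : SplitIdx k d' → ℤ :=
  Sum.elim
    (fun j => if j = pivot hk then S.c S.i₀ (Sum.inl (pivot hk)) * w (Sum.inl (Sum.inl ()))
      else w (Sum.inr (ρ, Sum.inl j)) + S.c S.i₀ (Sum.inl j) * w (Sum.inl (Sum.inl ())))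
    (fun m => w (Sum.inr (ρ, Sum.inr (Sum.inl m))) + S.c S.i₀ (Sum.inr m) * w (Sum.inl (Sum.inl ())))

/-- The recovery map is homogeneous. [folklore] -/
theorem SplitSys.recov_smul (ρ : Bool) (a : ℤ) (w : A₂Idx k d' → ℤ) :
    S.recov hk ρ (a • w) = a • S.recov hk ρ w := by
  funext v
  rcases v with j | m
  · simp only [SplitSys.recov, Sum.elim_inl, Pi.smul_apply, smul_eq_mul]
    split_ifs <;> ring
  · simp only [SplitSys.recov, Sum.elim_inr, Pi.smul_apply, smul_eq_mul]
    ring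

/-- The recovery map on the top forms gives `α c_{i₀}`. [folklore] -/
theorem SplitSys.recov_top (ai : ℤ) (ρ : Bool) (ω : Finset (Fin k)) :
    S.recov hk ρ ((S.sysA₂ hk ai).coeff (Sum.inl ω)) = S.c S.i₀ (Sum.inl (pivot hk)) • S.c S.i₀ := by
  funext v
  rcases v with j | m
  · simp only [SplitSys.recov, SplitSys.sysA₂, Sum.elim_inl, Sum.elim_inr, Pi.smul_apply,
      smul_eq_mul]
    split_ifs with hj
    · rw [hj]
    · ring
  · simp only [SplitSys.recov, SplitSys.sysA₂, Sum.elim_inl, Sum.elim_inr, Pi.smul_apply,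
      smul_eq_mul]
    ring

/-- The recovery map of the same copy on a lower form gives `α c_i`. [folklore] -/
theorem SplitSys.recov_low_same (ai : ℤ) (ρ : Bool) (φ : S.lowSig) :
    S.recov hk ρ ((S.sysA₂ hk ai).coeff (Sum.inr (ρ, φ))) =
      S.c S.i₀ (Sum.inl (pivot hk)) • S.c φ.1.2.2 := by
  funext v
  rcases v with j | m
  · simp only [SplitSys.recov, SplitSys.sysA₂, Sum.elim_inl, Sum.elim_inr, Pi.smul_apply,
      smul_eq_mul, if_true]
    split_ifs with hj
    · rw [hj]
    · ring
  · simp only [SplitSys.recov, SplitSys.sysA₂, Sum.elim_inl, Sum.elim_inr, Pi.smul_apply,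
      smul_eq_mul, if_true]
    ring

/-- The recovery map of the other copy on a lower form gives `ζ_i c_{i₀}`. [folklore] -/
theorem SplitSys.recov_low_other (ai : ℤ) {ρ ρ' : Bool} (hρ : ρ' ≠ ρ) (φ : S.lowSig) :
    S.recov hk ρ ((S.sysA₂ hk ai).coeff (Sum.inr (ρ', φ))) =
      S.c φ.1.2.2 (Sum.inl (pivot hk)) • S.c S.i₀ := by
  have hρ' : (ρ = ρ') = False := propext ⟨fun h => hρ h.symm, False.elim⟩
  funext v
  rcases v with j | m
  · simp only [SplitSys.recov, SplitSys.sysA₂, Sum.elim_inl, Sum.elim_inr, Pi.smul_apply,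
      smul_eq_mul, hρ', if_false]
    split_ifs with hj
    · rw [hj]; ring
    · ring
  · simp only [SplitSys.recov, SplitSys.sysA₂, Sum.elim_inl, Sum.elim_inr, Pi.smul_apply,
      smul_eq_mul, hρ', if_false]
    ring

/-- Lower forms are not the distinguished one. [folklore] -/
theorem SplitSys.lowSig_ne_i₀ (hT : S.Top) (φ : S.lowSig) : φ.1.2.2 ≠ S.i₀ := by
  obtain ⟨hC, _, hΩ⟩ := S.mem_lowSig φ.2
  intro h
  rw [h, S.Ω_i₀ hT] at hΩ
  rw [← hΩ] at hC
  exact hC.ne rfl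

/-- From `(aα) c = (bα) c'` with finite complexity: `a = b = 0` if `c, c'` are distinct forms.
[folklore] -/
theorem SplitSys.fc_smul_smul (hfc : S.FC) {i i' : Fin t} (hii : i ≠ i') {a b α β : ℤ}
    (hα : α ≠ 0) (hβ : β ≠ 0)
    (h : a • (α • S.c i) = b • (β • S.c i')) : a = 0 ∧ b = 0 := by
  rw [smul_smul, smul_smul] at h
  obtain ⟨h1, h2⟩ := hfc i i' hii _ _ h
  exact ⟨(mul_eq_zero.mp h1).resolve_right hα, (mul_eq_zero.mp h2).resolve_right hβ⟩

/-- **Finite complexity of `sysA₂`** ("no two of these forms are affinely dependent, that is to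
say no two of them have parallel homogeneous parts"), via the recovery maps.
[cite: GreenTao2010, App. C (the verification following the "slightly alarming expression")] -/
theorem SplitSys.sysA₂_fc (hfc : S.FC) (hnz : S.NZ) (hT : S.Top) (ai : ℤ) :
    (S.sysA₂ hk ai).FiniteComplexity := by
  have hα : S.c S.i₀ (Sum.inl (pivot hk)) ≠ 0 := hT _
  intro φ φ' hne a b hab
  have key : ∀ ρ, a • S.recov hk ρ ((S.sysA₂ hk ai).coeff φ) =
      b • S.recov hk ρ ((S.sysA₂ hk ai).coeff φ') := fun ρ => by
    rw [← S.recov_smul, ← S.recov_smul, hab]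
  rcases φ with ω | ⟨ρ, ψ⟩ <;> rcases φ' with ω' | ⟨ρ', ψ'⟩
  · -- top / top
    have h1 := key false
    rw [S.recov_top, S.recov_top, smul_smul, smul_smul] at h1
    have hab' : a = b := mul_right_cancel₀ hα (int_smul_cancel (hnz _) h1)
    subst hab'
    obtain ⟨j, hj⟩ : ∃ j, ¬ (j ∈ ω ↔ j ∈ ω') := by
      by_contra h; push Not at h
      exact hne (congr_arg Sum.inl (Finset.ext h))
    have h2 := congr_fun hab (Sum.inl (Sum.inr j))
    simp only [SplitSys.sysA₂, Pi.smul_apply, Sum.elim_inl, Sum.elim_inr, smul_eq_mul] at h2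
    have ha : a = 0 := by
      by_cases hjω : j ∈ ω
      · have hjω' : j ∉ ω' := fun h' => hj ⟨fun _ => h', fun _ => hjω⟩
        rw [if_pos hjω, if_neg hjω', mul_zero] at h2
        exact (mul_eq_zero.mp h2).resolve_right (mul_ne_zero hα (hT j))
      · have hjω' : j ∈ ω' := by
          by_contra h'; exact hj ⟨fun x => absurd x hjω, fun x => absurd x h'⟩
        rw [if_neg hjω, if_pos hjω', mul_zero] at h2
        exact (mul_eq_zero.mp h2.symm).resolve_right (mul_ne_zero hα (hT j))
    exact ⟨ha, ha⟩
  · -- top / low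
    have h1 := key ρ'
    rw [S.recov_top, S.recov_low_same] at h1
    exact S.fc_smul_smul hfc (S.lowSig_ne_i₀ hT ψ').symm hα hα h1
  · -- low / top
    have h1 := key ρ
    rw [S.recov_top, S.recov_low_same] at h1
    exact S.fc_smul_smul hfc (S.lowSig_ne_i₀ hT ψ) hα hα h1
  · -- low / low
    by_cases hρ : ρ' = ρ
    · subst hρ
      have h1 := key ρ'
      rw [S.recov_low_same, S.recov_low_same] at h1
      by_cases hi : ψ.1.2.2 = ψ'.1.2.2
      · -- same form: `a = b`, same `C`, different `ω`
        rw [← hi, smul_smul, smul_smul] at h1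
        have hab' : a = b := mul_right_cancel₀ hα (int_smul_cancel (hnz _) h1)
        subst hab'
        obtain ⟨hCB, hωC, hΩ⟩ := S.mem_lowSig ψ.2
        obtain ⟨hCB', hωC', hΩ'⟩ := S.mem_lowSig ψ'.2
        have hC : ψ.1.1 = ψ'.1.1 := by rw [← hΩ, ← hΩ', hi]
        have hω : ψ.1.2.1 ≠ ψ'.1.2.1 := by
          intro hω
          exact hne (congr_arg Sum.inr (Prod.ext rfl
            (Subtype.ext (Sigma.ext hC (heq_of_eq (Prod.ext hω hi))))))
        obtain ⟨c, hc⟩ : ∃ c, ¬ (c ∈ ψ.1.2.1 ↔ c ∈ ψ'.1.2.1) := by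
          by_contra h; push Not at h; exact hω (Finset.ext h)
        have hcC : c ∈ S.Ω ψ.1.2.2 := by
          rw [hΩ]
          rcases Decidable.em (c ∈ ψ.1.2.1) with h | h
          · exact hωC h
          · have : c ∈ ψ'.1.2.1 := by
              by_contra h'; exact hc ⟨fun x => absurd x h, fun x => absurd x h'⟩
            rw [hC]; exact hωC' this
        obtain ⟨j, _, rfl⟩ := Finset.mem_map.mp hcC
        have hcne : S.c ψ.1.2.2 (Sum.inl j) ≠ 0 := S.mem_Ω.mp hcC
        have h2 := congr_fun hab (Sum.inl (Sum.inr j))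
        simp only [SplitSys.sysA₂, Pi.smul_apply, Sum.elim_inl, Sum.elim_inr, smul_eq_mul] at h2
        rw [← hi] at h2
        have ha : a = 0 := by
          by_cases hjω : (Sum.inl j : SplitIdx k d') ∈ ψ.1.2.1
          · have hjω' : (Sum.inl j : SplitIdx k d') ∉ ψ'.1.2.1 :=
              fun h' => hc ⟨fun _ => h', fun _ => hjω⟩
            rw [if_pos hjω, if_neg hjω', mul_zero] at h2
            exact (mul_eq_zero.mp h2).resolve_right (mul_ne_zero hα hcne)
          · have hjω' : (Sum.inl j : SplitIdx k d') ∈ ψ'.1.2.1 := by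
              by_contra h'; exact hc ⟨fun x => absurd x hjω, fun x => absurd x h'⟩
            rw [if_neg hjω, if_pos hjω', mul_zero] at h2
            exact (mul_eq_zero.mp h2.symm).resolve_right (mul_ne_zero hα hcne)
        exact ⟨ha, ha⟩
      · exact S.fc_smul_smul hfc hi hα hα h1
    · -- different copies: `a = 0`, then `b = 0` by non-constancy
      have h1 := key ρ
      rw [S.recov_low_same, S.recov_low_other hk ai hρ] at h1
      have ha : a = 0 := by
        by_cases hζ : S.c ψ'.1.2.2 (Sum.inl (pivot hk)) = 0
        · rw [hζ, zero_smul, smul_zero] at h1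
          rw [smul_smul] at h1
          exact (mul_eq_zero.mp (smul_eq_zero.mp h1 |>.resolve_right (hnz _))).resolve_right hα
        · exact (S.fc_smul_smul hfc (S.lowSig_ne_i₀ hT ψ) hα hζ h1).1
      subst ha
      rw [zero_smul] at hab
      have hb : b = 0 := by
        by_contra hb
        have hzero : (S.sysA₂ hk ai).coeff (Sum.inr (ρ', ψ')) = 0 :=
          (smul_eq_zero.mp hab.symm).resolve_left hb
        have := S.recov_low_same hk ai ρ' ψ'
        rw [hzero] at this
        have h0 : S.recov hk ρ' (0 : A₂Idx k d' → ℤ) = 0 := by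
          funext v; rcases v with j | m <;> simp [SplitSys.recov]
        rw [h0] at this
        exact (smul_ne_zero hα (hnz ψ'.1.2.2)) this.symm
      exact ⟨rfl, hb⟩

/-- `sysA₂` is non-constant. [folklore] -/
theorem SplitSys.sysA₂_nz (hnz : S.NZ) (hT : S.Top) (ai : ℤ) : (S.sysA₂ hk ai).Nonzero := by
  intro φ h
  rcases φ with ω | ⟨ρ, ψ⟩
  · have := congr_fun h (Sum.inl (Sum.inl ()))
    simp only [SplitSys.sysA₂, Sum.elim_inl, Pi.zero_apply] at this
    exact hT _ this
  · have := S.recov_low_same hk ai ρ ψ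
    rw [h] at this
    have h0 : S.recov hk ρ (0 : A₂Idx k d' → ℤ) = 0 := by
      funext v; rcases v with j | m <;> simp [SplitSys.recov]
    rw [h0] at this
    exact (smul_ne_zero (hT _) (hnz ψ.1.2.2)) this.symm

/-- Coefficient bound `2L²` for `sysA₂`. [folklore] -/
theorem SplitSys.sysA₂_bound {L : ℕ} (hL : 1 ≤ L) (hB : S.Bound L) (ai : ℤ) :
    (S.sysA₂ hk ai).CoeffBound (2 * L ^ 2) := by
  have hL2 : (L : ℤ) ≤ 2 * (L : ℤ) ^ 2 := by nlinarith
  have hprod : ∀ x y : ℤ, |x| ≤ L → |y| ≤ L → |x * y| ≤ (L : ℤ) ^ 2 := by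
    intro x y hx hy
    rw [abs_mul, sq]
    exact mul_le_mul hx hy (abs_nonneg _) (by positivity)
  have hdiff : ∀ x y x' y' : ℤ, |x| ≤ L → |y| ≤ L → |x'| ≤ L → |y'| ≤ L →
      |x * y - x' * y'| ≤ 2 * (L : ℤ) ^ 2 := by
    intro x y x' y' hx hy hx' hy'
    calc |x * y - x' * y'| ≤ |x * y| + |x' * y'| := abs_sub _ _
      _ ≤ (L : ℤ) ^ 2 + (L : ℤ) ^ 2 := add_le_add (hprod _ _ hx hy) (hprod _ _ hx' hy')
      _ = 2 * (L : ℤ) ^ 2 := by ring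
  intro φ v
  push_cast
  rcases φ with ω | ⟨ρ, ψ⟩
  · rcases v with (_ | j) | _
    · simp only [SplitSys.sysA₂, Sum.elim_inl]; exact (hB _ _).trans hL2
    · simp only [SplitSys.sysA₂, Sum.elim_inl, Sum.elim_inr]
      split_ifs
      · exact (hprod _ _ (hB _ _) (hB _ _)).trans (by nlinarith)
      · simp
    · simp only [SplitSys.sysA₂, Sum.elim_inr, abs_zero]; positivity
  · rcases v with (_ | j) | ⟨ρ', j | m | m⟩
    · simp only [SplitSys.sysA₂, Sum.elim_inl]; exact (hB _ _).trans hL2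
    · simp only [SplitSys.sysA₂, Sum.elim_inl, Sum.elim_inr]
      split_ifs
      · exact (hprod _ _ (hB _ _) (hB _ _)).trans (by nlinarith)
      · simp
    · simp only [SplitSys.sysA₂, Sum.elim_inr, Sum.elim_inl]
      split_ifs
      · simp
      · exact hdiff _ _ _ _ (hB _ _) (hB _ _) (hB _ _) (hB _ _)
      · simp
    · simp only [SplitSys.sysA₂, Sum.elim_inr, Sum.elim_inl]
      split_ifs
      · exact hdiff _ _ _ _ (hB _ _) (hB _ _) (hB _ _) (hB _ _)
      · simp
    · simp only [SplitSys.sysA₂, Sum.elim_inr]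
      split_ifs <;> simp

/-- `lowSig ⊆ tbSig A`, hence at most `4^k t` elements. [folklore] -/
theorem SplitSys.card_lowSig_le : S.lowSig.card ≤ 2 ^ k * 2 ^ k * t := by
  refine (Finset.card_le_card ?_).trans (S.card_tbSig_le _ (Finset.Subset.refl _))
  unfold SplitSys.lowSig SplitSys.tbSig
  exact Finset.sigma_mono (Finset.erase_subset _ _) fun _ => Finset.Subset.refl _

/-- **`A₂ = 1 + O(η)`** under the `(D₀,D₀,D₀)`-linear forms condition with
`D₀ ≥ 2^k + 2·4^k t, 3k + 4d' + 1, 2L²`. [cite: GreenTao2010, App. C ("We have verified that it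
was valid to invoke the linear forms condition, provided that `D` is large enough")] -/
theorem SplitSys.abs_topA₂_sub_one_le {N' : ℕ} [NeZero N'] {D₀ L : ℕ} {η : ℝ} {ν₀ : ZMod N' → ℝ}
    (hLFC : LinearFormsCondition D₀ D₀ D₀ η ν₀) (hfc : S.FC) (hnz : S.NZ) (hT : S.Top)
    (hL : 1 ≤ L) (hB : S.Bound L) (hunit : IsUnit (S.a N' (pivot hk))) {ainv : ZMod N'}
    (hainv : S.a N' (pivot hk) * ainv = 1)
    (hD1 : 2 ^ k + 2 * (2 ^ k * 2 ^ k * t) ≤ D₀) (hD2 : 1 + k + 2 * (k + (d' + d')) ≤ D₀)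
    (hD3 : 2 * L ^ 2 ≤ D₀) :
    |topA₂ hk ν₀ (S.a N') ainv (S.b₀ N') (S.νfam N' ν₀) - 1| ≤ η := by
  have hai : (((ainv.val : ℕ) : ℤ) : ZMod N') = ainv := by
    rw [Int.cast_natCast, ZMod.natCast_zmod_val]
  rw [S.topA₂_eq hk hunit hainv hai]
  refine (S.sysA₂ hk _).abs_expect_prod_sub_one_le hLFC (S.sysA₂_fc hk hfc hnz hT _)
    (S.sysA₂_nz hk hnz hT _) (S.sysA₂_bound hk hL hB _) hD3 ?_ ?_ ?_ ?_
  · rw [Fintype.card_sum]; exact le_add_right (by rw [Fintype.card_finset]; exact Nat.one_le_two_pow)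
  · rw [Fintype.card_sum, Fintype.card_prod, Fintype.card_bool, Fintype.card_coe,
      Fintype.card_finset, Fintype.card_fin]
    exact (Nat.add_le_add_left (Nat.mul_le_mul_left 2 S.card_lowSig_le) _).trans hD1
  · simp only [Fintype.card_sum, Fintype.card_prod, Fintype.card_bool, Fintype.card_unique,
      Fintype.card_fin]; omega
  · simp only [Fintype.card_sum, Fintype.card_prod, Fintype.card_bool, Fintype.card_unique,
      Fintype.card_fin]; omega

end atwofc



/-! ### Assembly: the reduced generalised von Neumann theorem for split systems -/

section assembly

variable {k d' t : ℕ} (S : SplitSys k d' t) (hk : 1 ≤ k) {N' : ℕ}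

/-- The cutoff factor attached to `B ⊆ A`: the private cutoff `χ_{x_j}` for `B = {x_j}`, all the
`y`-cutoffs for `B = ∅`, nothing otherwise (for `k ≥ 2` every cutoff is lower order).
[cite: GreenTao2010, App. C (grouping by `Ω`)] -/
def cutFam (χ : SplitIdx k d' → ZMod N' → ℝ) (B : Finset (SplitIdx k d')) (p : SplitIdx k d' → ZMod N') : ℝ :=
  (∏ j ∈ Finset.univ.filter (fun j : Fin k => B = {Sum.inl j}), χ (Sum.inl j) (p (Sum.inl j))) *
    (if B = ∅ then ∏ m, χ (Sum.inr m) (p (Sum.inr m)) else 1)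

/-- The functions attached to `B ⊆ A`: `F_B = (∏_{i : Ω(i) = B} g_i(θ_i)) · (cutoffs of level B)`.
[cite: GreenTao2010, App. C ("`F_{B,y}(x_B) := ∏_{i : Ω(i) = B} f_i(ψ_i(x_B,y))`")] -/
def SplitSys.fFam (g : Fin t → ZMod N' → ℝ) (χ : SplitIdx k d' → ZMod N' → ℝ)
    (B : Finset (SplitIdx k d')) (p : SplitIdx k d' → ZMod N') : ℝ :=
  (∏ i ∈ S.I B, g i (S.θ N' i p)) * cutFam χ B p

/-- `|cutoff factor| ≤ 1`. [folklore] -/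
theorem abs_cutFam_le {χ : SplitIdx k d' → ZMod N' → ℝ} (hχ : ∀ v x, |χ v x| ≤ 1)
    (B : Finset (SplitIdx k d')) (p : SplitIdx k d' → ZMod N') : |cutFam χ B p| ≤ 1 := by
  unfold cutFam
  rw [abs_mul]
  refine mul_le_one₀ ?_ (abs_nonneg _) ?_
  · rw [Finset.abs_prod]
    exact Finset.prod_le_one (fun _ _ => abs_nonneg _) fun _ _ => hχ _ _
  · split_ifs
    · rw [Finset.abs_prod]
      exact Finset.prod_le_one (fun _ _ => abs_nonneg _) fun _ _ => hχ _ _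
    · simp

/-- Domination `|F_B| ≤ ν_B`. [cite: GreenTao2010, App. C ("we have the pointwise bounds
`|F_{B,y}(x_B)| ≤ ν_{B,y}(x_B)`")] -/
theorem SplitSys.abs_fFam_le {g : Fin t → ZMod N' → ℝ} {ν₀ : ZMod N' → ℝ}
    (hg : ∀ i x, |g i x| ≤ ν₀ x) {χ : SplitIdx k d' → ZMod N' → ℝ} (hχ : ∀ v x, |χ v x| ≤ 1)
    (B : Finset (SplitIdx k d')) (p : SplitIdx k d' → ZMod N') :
    |S.fFam g χ B p| ≤ S.νfam N' ν₀ B p := by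
  unfold SplitSys.fFam SplitSys.νfam
  rw [abs_mul, Finset.abs_prod]
  have h1 : ∏ i ∈ S.I B, |g i (S.θ N' i p)| ≤ ∏ i ∈ S.I B, ν₀ (S.θ N' i p) :=
    Finset.prod_le_prod (fun _ _ => abs_nonneg _) fun _ _ => hg _ _
  calc (∏ i ∈ S.I B, |g i (S.θ N' i p)|) * |cutFam χ B p|
      ≤ (∏ i ∈ S.I B, ν₀ (S.θ N' i p)) * 1 :=
        mul_le_mul h1 (abs_cutFam_le hχ B p) (abs_nonneg _)
          (Finset.prod_nonneg fun i _ => (abs_nonneg _).trans (hg i _))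
    _ = _ := mul_one _

/-- The form `θ_i` only reads the private coordinates in `Ω(i)` and the coordinates `y`.
[cite: GreenTao2010, App. C ("regarding `f_i` as a function on `ℤ_{N'}^B × ℤ_{N'}^{d-s-1}`")] -/
theorem SplitSys.θ_dependsOn (i : Fin t) :
    DependsOn (S.θ N' i) ((↑(S.Ω i) : Set (SplitIdx k d')) ∪ (↑(privSet k d') : Set _)ᶜ) := by
  intro p q hpq
  unfold SplitSys.θ
  congr 1
  refine Fintype.sum_congr _ _ fun v => ?_
  by_cases hv : S.c i v = 0
  · simp [hv]
  · rw [hpq v]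
    rcases v with j | m
    · exact Or.inl (Finset.mem_coe.mpr (S.mem_Ω.mpr hv))
    · right
      simp [privSet]

/-- `F_B` depends only on `x_B` and `y`. [cite: GreenTao2010, App. C] -/
theorem SplitSys.fFam_dependsOn (g : Fin t → ZMod N' → ℝ) (χ : SplitIdx k d' → ZMod N' → ℝ)
    (B : Finset (SplitIdx k d')) :
    DependsOn (S.fFam g χ B) ((↑B : Set (SplitIdx k d')) ∪ (↑(privSet k d') : Set _)ᶜ) := by
  intro p q hpq
  unfold SplitSys.fFam cutFam
  congr 1
  · refine Finset.prod_congr rfl fun i hi => ?_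
    have hΩ : S.Ω i = B := (Finset.mem_filter.mp hi).2
    rw [S.θ_dependsOn i (fun v hv => hpq v (by rwa [hΩ] at hv))]
  · congr 1
    · refine Finset.prod_congr rfl fun j hj => ?_
      have hB : B = {Sum.inl j} := (Finset.mem_filter.mp hj).2
      rw [hpq (Sum.inl j) (Or.inl (by rw [hB]; simp))]
    · split_ifs
      · refine Fintype.prod_congr _ _ fun m => ?_
        rw [hpq (Sum.inr m) (Or.inr (by simp [privSet]))]
      · rfl

/-- `ν_B` depends only on `x_B` and `y`. [cite: GreenTao2010, App. C] -/
theorem SplitSys.νfam_dependsOn (ν₀ : ZMod N' → ℝ) (B : Finset (SplitIdx k d')) :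
    DependsOn (S.νfam N' ν₀ B) ((↑B : Set (SplitIdx k d')) ∪ (↑(privSet k d') : Set _)ᶜ) := by
  intro p q hpq
  unfold SplitSys.νfam
  refine Finset.prod_congr rfl fun i hi => ?_
  have hΩ : S.Ω i = B := (Finset.mem_filter.mp hi).2
  rw [S.θ_dependsOn i (fun v hv => hpq v (by rwa [hΩ] at hv))]

/-- For `k ≥ 2` the top function is `g_{i₀} ∘ θ₀`. [cite: GreenTao2010, App. C
("`F_{[s+1],y}(x_{[s+1]}) = f₁(ψ₁(x_{[s+1]},y))`")] -/
theorem SplitSys.fFam_privSet (hk2 : 2 ≤ k) (hT : S.Top) (hL : S.Low) (g : Fin t → ZMod N' → ℝ)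
    (χ : SplitIdx k d' → ZMod N' → ℝ) :
    S.fFam g χ (privSet k d') = fun p => g S.i₀ (topForm (S.a N') (S.b₀ N') p) := by
  funext p
  unfold SplitSys.fFam cutFam
  rw [S.I_privSet hT hL, Finset.prod_singleton, S.θ_i₀]
  have h1 : Finset.univ.filter (fun j : Fin k => privSet k d' = {Sum.inl j}) = ∅ := by
    refine Finset.filter_false_of_mem fun j _ h => ?_
    have := congr_arg Finset.card h
    rw [card_privSet, Finset.card_singleton] at this
    omega
  have h2 : privSet k d' ≠ ∅ := by
    intro h
    have := congr_arg Finset.card h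
    rw [card_privSet, Finset.card_empty] at this
    omega
  rw [h1, Finset.prod_empty, if_neg h2, one_mul, mul_one]

/-- The product of the `F_B` over `B ⊆ A` is the full multilinear form.
[cite: GreenTao2010, App. C ("we may write the left-hand side … as `𝔼 ∏_{B ⊆ [s+1]} F_{B,y}(x_B)`")] -/
theorem SplitSys.prod_fFam (g : Fin t → ZMod N' → ℝ) (χ : SplitIdx k d' → ZMod N' → ℝ)
    (p : SplitIdx k d' → ZMod N') :
    ∏ B ∈ (privSet k d').powerset, S.fFam g χ B p =
      (∏ i, g i (S.θ N' i p)) * ∏ v, χ v (p v) := by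
  unfold SplitSys.fFam cutFam
  rw [Finset.prod_mul_distrib, Finset.prod_mul_distrib]
  congr 1
  · -- the forms, grouped by `Ω`
    unfold SplitSys.I
    exact Finset.prod_fiberwise_of_maps_to (g := S.Ω) (fun i _ => Finset.mem_powerset.mpr
      (S.Ω_subset i)) (fun i => g i (S.θ N' i p))
  · rw [Fintype.prod_sum_type]
    congr 1
    · -- the private cutoffs, one for each singleton
      rw [← Finset.prod_fiberwise_of_maps_to (s := (Finset.univ : Finset (Fin k)))
        (t := (privSet k d').powerset) (g := fun j => ({Sum.inl j} : Finset (SplitIdx k d')))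
        (fun j _ => Finset.mem_powerset.mpr (by simp [privSet]))
        (f := fun j => χ (Sum.inl j) (p (Sum.inl j)))]
      refine Finset.prod_congr rfl fun B _ => Finset.prod_congr ?_ fun _ _ => rfl
      ext j; simp [eq_comm]
    · rw [Finset.prod_ite_eq' (privSet k d').powerset (∅ : Finset (SplitIdx k d'))
        (fun _ => ∏ m, χ (Sum.inr m) (p (Sum.inr m))), if_pos (Finset.empty_mem_powerset _)]

/-- A pseudorandomness degree sufficient for all the linear forms averages of the reduced
generalised von Neumann argument with `k` private and `d'` other variables, `t` forms of size
`L`. [cite: GreenTao2010, App. C ("provided that the degree `D` of pseudorandomness is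
sufficiently large")] -/
def coreDegree (k d' t L : ℕ) : ℕ :=
  2 ^ k + 2 * (2 ^ k * 2 ^ k * t) + (1 + k + 2 * (k + (d' + d'))) + 2 * L ^ 2 + 2 * (k + d')

variable [NeZero N']

/-- **The reduced generalised von Neumann theorem for split systems, quantitative form**
(Green–Tao 2010, App. C, Proposition 7.1″ with cutoffs): for a finite-complexity split system
with distinguished form `θ_{i₀}` involving all `k ≥ 2` private coordinates with unit
coefficients and every other form missing one of them, functions `|g_i| ≤ ν` and cutoffs
`|χ_v| ≤ 1` of single coordinates, and `ν` satisfying the `(D,D,D)`-linear forms condition with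
error `η` for `D ≥ coreDegree`,
`|𝔼_p ∏_i g_i(θ_i(p)) ∏_v χ_v(p_v)|^{2^k} ≤ (‖g_{i₀}‖_{U^k(ℤ_{N'})}^{2^k} + ((1+η) 4η)^{1/2}) (1+η)^{2^k-1}`.
[cite: GreenTao2010, App. C (Proposition 7.1″ and its proof)] -/
theorem SplitSys.coreGvN_concrete (hk2 : 2 ≤ k) (hfc : S.FC) (hnz : S.NZ) (hT : S.Top)
    (hLow : S.Low) {L : ℕ} (hL1 : 1 ≤ L) (hB : S.Bound L) (hunit : ∀ j, IsUnit (S.a N' j))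
    {D₀ : ℕ} {η : ℝ} (hη : 0 ≤ η) {ν₀ : ZMod N' → ℝ} (hν₀ : ∀ x, 0 ≤ ν₀ x)
    (hLFC : LinearFormsCondition D₀ D₀ D₀ η ν₀) (hD : coreDegree k d' t L ≤ D₀)
    {g : Fin t → ZMod N' → ℝ} (hg : ∀ i x, |g i x| ≤ ν₀ x)
    {χ : SplitIdx k d' → ZMod N' → ℝ} (hχ : ∀ v x, |χ v x| ≤ 1) :
    |𝔼 p : SplitIdx k d' → ZMod N', (∏ i, g i (S.θ N' i p)) * ∏ v, χ v (p v)| ^ (2 ^ k) ≤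
      (gowersPower k (g S.i₀) + Real.sqrt ((1 + η) * (4 * η))) * (1 + η) ^ (2 ^ k - 1) := by
  have hk : 1 ≤ k := by omega
  -- the inverse of the pivot coefficient
  obtain ⟨u, hu⟩ := hunit (pivot hk)
  set ainv : ZMod N' := ((u⁻¹ : (ZMod N')ˣ) : ZMod N') with hainv_def
  have hainv : S.a N' (pivot hk) * ainv = 1 := by rw [← hu, hainv_def, Units.mul_inv]
  -- degrees
  have hDs : 2 ^ k ≤ D₀ ∧ k + 1 ≤ D₀ ∧ L ≤ D₀ ∧ 2 ^ k * 2 ^ k * t ≤ D₀ ∧ 2 * (k + d') ≤ D₀ ∧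
      2 ^ k + 2 * (2 ^ k * 2 ^ k * t) ≤ D₀ ∧ 1 + k + 2 * (k + (d' + d')) ≤ D₀ ∧ 2 * L ^ 2 ≤ D₀ := by
    unfold coreDegree at hD
    have hL2 : L ≤ 2 * L ^ 2 := by nlinarith
    generalize hAg : 2 ^ k = A at hD ⊢
    generalize hBg : A * A * t = B at hD ⊢
    generalize hCg : L ^ 2 = C at hD hL2 ⊢
    refine ⟨?_, ?_, ?_, ?_, ?_, ?_, ?_, ?_⟩ <;> omega
  obtain ⟨hD1, hD2, hD3, hD4, hD5, hD6, hD7, hD8⟩ := hDs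
  -- the abstract inequality
  have hcore := coreGvN hk hunit hainv (S.b₀ N') (hg S.i₀) (S.fFam g χ) (S.νfam N' ν₀)
    (S.fFam_privSet hk2 hT hLow g χ) (fun B _ => S.fFam_dependsOn g χ B)
    (fun B _ => S.νfam_dependsOn ν₀ B)
    (fun B p => Finset.prod_nonneg fun i _ => hν₀ _) (fun B _ p => S.abs_fFam_le hg hχ B p)
  simp_rw [S.prod_fFam g χ] at hcore
  refine hcore.trans ?_
  -- the linear forms condition bounds
  have h0 := S.abs_topA₀_sub_one_le (N' := N') hLFC hT hL1 hB hD3 hD1 hD2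
  have hkd : 1 ≤ k + d' := by omega
  have hlow : ∀ B, B ⊆ privSet k d' → |wBoxPower (S.νfam N' ν₀) B (S.νfam N' ν₀ B) - 1| ≤ η :=
    fun B hBA => S.abs_wBoxPower_νfam_sub_one_le hLFC hη hfc hnz hB hD3 hD4 hD5 hkd B hBA
  have h1 : |topA₁ hk ν₀ (S.a N') ainv (S.b₀ N') (S.νfam N' ν₀) - 1| ≤ η := by
    rw [topA₁_eq_wBoxPower hk hainv]
    have : (fun p => ν₀ (topForm (S.a N') (S.b₀ N') p)) = S.νfam N' ν₀ (privSet k d') := by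
      funext p; unfold SplitSys.νfam; rw [S.I_privSet hT hLow, Finset.prod_singleton, S.θ_i₀]
    rw [this]
    exact hlow _ (Finset.Subset.refl _)
  have h2 := S.abs_topA₂_sub_one_le hk hLFC hfc hnz hT hL1 hB (hunit _) hainv hD6 hD7 hD8
  -- numerical consequences
  have hA₀ : topA₀ ν₀ (S.a N') ≤ 1 + η := by linarith [(abs_le.mp h0).2]
  have hA₀nn : 0 ≤ topA₀ ν₀ (S.a N') :=
    Finset.expect_nonneg fun q _ => by
      unfold topV gowersProd; exact Finset.prod_nonneg fun _ _ => hν₀ _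
  have hmid : |topA₂ hk ν₀ (S.a N') ainv (S.b₀ N') (S.νfam N' ν₀) -
      2 * topA₁ hk ν₀ (S.a N') ainv (S.b₀ N') (S.νfam N' ν₀) + topA₀ ν₀ (S.a N')| ≤ 4 * η := by
    have e : topA₂ hk ν₀ (S.a N') ainv (S.b₀ N') (S.νfam N' ν₀) -
        2 * topA₁ hk ν₀ (S.a N') ainv (S.b₀ N') (S.νfam N' ν₀) + topA₀ ν₀ (S.a N') =
        (topA₂ hk ν₀ (S.a N') ainv (S.b₀ N') (S.νfam N' ν₀) - 1) -
          2 * (topA₁ hk ν₀ (S.a N') ainv (S.b₀ N') (S.νfam N' ν₀) - 1) + (topA₀ ν₀ (S.a N') - 1) := by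
      ring
    rw [e]
    calc |(topA₂ hk ν₀ (S.a N') ainv (S.b₀ N') (S.νfam N' ν₀) - 1) -
          2 * (topA₁ hk ν₀ (S.a N') ainv (S.b₀ N') (S.νfam N' ν₀) - 1) + (topA₀ ν₀ (S.a N') - 1)|
        ≤ |topA₂ hk ν₀ (S.a N') ainv (S.b₀ N') (S.νfam N' ν₀) - 1| +
          |2 * (topA₁ hk ν₀ (S.a N') ainv (S.b₀ N') (S.νfam N' ν₀) - 1)| + |topA₀ ν₀ (S.a N') - 1| :=
          (abs_add_le _ _).trans (add_le_add (abs_sub _ _) le_rfl)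
      _ ≤ η + 2 * η + η := by
          rw [abs_mul, abs_two]
          exact add_le_add (add_le_add h2 (mul_le_mul_of_nonneg_left h1 zero_le_two)) h0
      _ = 4 * η := by ring
  have hsqrt : Real.sqrt (topA₀ ν₀ (S.a N') *
      |topA₂ hk ν₀ (S.a N') ainv (S.b₀ N') (S.νfam N' ν₀) -
        2 * topA₁ hk ν₀ (S.a N') ainv (S.b₀ N') (S.νfam N' ν₀) + topA₀ ν₀ (S.a N')|) ≤
      Real.sqrt ((1 + η) * (4 * η)) :=
    Real.sqrt_le_sqrt (mul_le_mul hA₀ hmid (abs_nonneg _) (by linarith))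
  have hprod : ∏ B ∈ (privSet k d').ssubsets, wBoxPower (S.νfam N' ν₀) B (S.νfam N' ν₀ B) ≤
      (1 + η) ^ (2 ^ k - 1) := by
    have hcard : (privSet k d').ssubsets.card = 2 ^ k - 1 := by
      show ((privSet k d').powerset.erase (privSet k d')).card = _
      rw [Finset.card_erase_of_mem (Finset.mem_powerset_self _), Finset.card_powerset, card_privSet]
    rw [← hcard, ← Finset.prod_const]
    refine Finset.prod_le_prod (fun B _ => Finset.expect_nonneg fun pp _ =>
      mul_nonneg (Finset.prod_nonneg fun _ _ => Finset.prod_nonneg fun _ _ => hν₀ _)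
        (Finset.prod_nonneg fun _ _ => Finset.prod_nonneg fun _ _ =>
          Finset.prod_nonneg fun _ _ => hν₀ _)) fun B hB' => ?_
    have hBA : B ⊆ privSet k d' := (Finset.mem_ssubsets.mp hB').subset
    linarith [(abs_le.mp (hlow B hBA)).2]
  have hgp : 0 ≤ gowersPower k (g S.i₀) := gowersPower_nonneg hk _
  exact mul_le_mul (add_le_add le_rfl hsqrt) hprod (Finset.prod_nonneg fun B _ =>
    Finset.expect_nonneg fun pp _ => mul_nonneg
      (Finset.prod_nonneg fun _ _ => Finset.prod_nonneg fun _ _ => hν₀ _)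
      (Finset.prod_nonneg fun _ _ => Finset.prod_nonneg fun _ _ =>
        Finset.prod_nonneg fun _ _ => hν₀ _))
    (add_nonneg hgp (Real.sqrt_nonneg _))

end assembly


end Literature.NumberTheory.Sieve
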